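import Literature.Analysis.FluidPDE.ChaeAsymptoticallySelfSimilarProofs
import Literature.Analysis.FluidPDE.ClassicalBoundedWeak
import Literature.Analysis.FluidPDE.ClassicalSolutionRescale
import HarnessLib

/-!
# Chae 2007, Theorem 1.5: the weak limit of the blow-up rescalings (proofs companion, II)

Analysis/FluidPDE proofs file (theorems only: no definitions, no named facts) on the discharge
path of the named fact `Literature.Analysis.FluidPDE.chae2007_asymptoticallySelfSimilar_local`
(`ChaeAsymptoticallySelfSimilar.lean`; D. Chae, *Nonexistence of asymptotically self-similar
singularities in the Euler and the Navier–Stokes equations*, Math. Ann. 338 (2007) 435–449 =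
arXiv:math/0604234, **Theorem 1.5**), continuing `ChaeAsymptoticallySelfSimilarProofs.lean`,
which turned the hypothesis of Theorem 1.5 into the convergence of the Navier–Stokes blow-up
rescalings `v_λ = nsRescale λ (v(T + ·, z + ·))` about `(T, z)` to the backward self-similar
field `u_V = lerayBackward ½ 0 V` (`u_V(s, y) = (−s)^{-1/2} V(y/√(−s))`):
`sup_{−1<s<0} ‖v_λ(s) − u_V(s)‖_{L^q(B(0,R))} → 0` as `λ ↓ 0`, for every `R > 0`
(`tendsto_iSup_nsRescale_sub_lerayBackward`, `forall_tendsto_chaeLocalDeviation_of_hyp`).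

This file PROVES the next step of the printed proof (arXiv p. 8: "Using this convergence, we can
pass to the limit `s → ∞` in the weak formulation of `(NS₁)` … we find that `V̄` is a weak
solution of the stationary Leray system"; here in the tree's rescaling vocabulary, i.e. before
the passage to the similarity variables `(y, s)`): **the limit field `u_V` is a very weak solution
of the Navier–Stokes equations on the slab `(−1, 0) × ℝ³`** — it satisfies
`∫_{−1}^{0} ∫ (⟪u, ∂ₜψ⟫ + ⟪u, (u·∇)ψ⟫ + ⟪u, Δψ⟫) dx dt = 0` for every smooth compactly supported
test field `ψ` on the slab with divergence-free slices (the pressure-free weak formulation of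
Koch–Nadirashvili–Seregin–Šverák 2009, §4 (ii), without their boundedness), and its slices are
weakly divergence free:

* `IsClassicalNSSolutionOn.integral_veryWeak_eq_zero` — a classical solution on an open time
  interval satisfies the very weak identity (the pressure pairs to zero with divergence-free
  fields, so no growth condition on it is needed; the proof of the accepted
  `IsClassicalNSSolutionOn.isBoundedWeakNSSolutionOn`, which uses boundedness only to fill the
  `L^∞` clause of KNSS's class);
* `IsClassicalNSSolutionOn.nsRescale_blowup` — the rescalings `v_λ`, `0 < λ`, `λ² ≤ T`, are
  classical solutions on `(−1, 0)` (the accepted covariance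
  `IsClassicalNSSolutionOn.nsRescale_translate_zero`);
* `integral_veryWeak_eq_zero_of_tendsto` — **the abstract limit theorem**: if fields `w_i`,
  continuous on the slab and satisfying the very weak identity, converge to `U` in
  `L^∞((−1,0); L^q(B(0,R)))` for every `R` along a countably generated filter, `q ≥ 2`, and the
  slices of `U` are measurable and locally `L^q`, uniformly on compact time intervals, then `U`
  satisfies the very weak identity (dominated convergence in time over the slice estimate
  `lintegral_veryWeakIntegrand_sub_le`: `∫|F(w) − F(U)| ≤ M‖w−U‖_{L²(B_R)}((1+|ν|)|B_R|^{1/2} +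
  ‖w−U‖_{L²(B_R)} + 2‖U‖_{L²(B_R)})`, `L² ≤ |B_R|^{1/2−1/q} L^q` on the ball);
* `isWeaklyDivFree_of_tendsto_eLpNorm_sub` — weak divergence-freeness passes to local `L^q`
  limits, `q ≥ 1`;
* `eLpNorm_profile_lt_top_of_tendsto_chaeLocalDeviation` — under the hypothesis of Theorem 1.5 the
  profile is automatically in `L^q_loc` (the deviation is eventually finite, the classical slice
  `v(τ)` is bounded on balls, and `x = z + √(T−τ) y` — the change of variables
  `eLpNorm_comp_add_smul_restrict_ball` of the first companion);
* `integral_veryWeak_lerayBackward_eq_zero`, `isWeaklyDivFree_lerayBackward_slice` — **the weak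
  limit in Chae's setting**: for `T > 0`, a classical solution `(v, π)` of Navier–Stokes
  (`ν = 1`, `f = 0`) on `(0, T)`, a measurable profile `V`, `q ≥ 2` and the deviation tending to
  `0` for every `R > 0`, the field `u_V` is a very weak solution on the slab `(−1, 0) × ℝ³` with
  weakly divergence-free slices.

What remains of the printed proof of Theorem 1.5 after this file: the identification of the very
weak self-similar solution `u_V` (`V ∈ L^p`, `p ≥ 3`) with a smooth Leray profile
(`IsLerayProfile 1 ½ V P`, so that `necas_ruzicka_sverak_holds` / `tsai_selfsimilar_holds` give
`V = 0`), and the ε-regularity step (Gustafson–Kang–Tsai) at `(T, z)`.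

## References

* D. Chae, Math. Ann. 338 (2007) 435–449 = arXiv:math/0604234, Theorem 1.5 and its proof,
  arXiv pp. 7–8 (the passage to the limit in the weak formulation, p. 8) [Chae2007].
* G. Koch, N. Nadirashvili, G. Seregin, V. Šverák, Acta Math. 203 (2009) = arXiv:0709.3599, §4
  (ii) p. 8 (weak solutions tested with divergence-free fields) [KochNadirashviliSereginSverak2009].
* T. Y. Hou, R. Li, *Nonexistence of locally self-similar blow-up for the 3D incompressible
  Navier–Stokes equations*, Discrete Contin. Dyn. Syst. 18 (2007) = arXiv:math/0603126, §3 (the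
  same limit for `p > 3`) [HouLi2007].
-/

noncomputable section

open _root_.MeasureTheory Set Function Filter Metric TopologicalSpace InnerProductSpace
open scoped NNReal ENNReal _root_.Topology RealInnerProductSpace Laplacian ContDiff

namespace Literature.Analysis.FluidPDE

section VeryWeak

variable {E : Type*} [NormedAddCommGroup E] [InnerProductSpace ℝ E] [FiniteDimensional ℝ E]
  [MeasurableSpace E] [BorelSpace E]

/-- **Classical solutions are very weak solutions.** A classical solution `(u, p)` of the
unforced Navier–Stokes system on `E × (a, b)` satisfies, for every smooth compactly supported
test field `ψ` on the slab `(a, b) × E` with divergence-free slices,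
`∫ₐᵇ ∫ (⟪u, ∂ₜψ⟫ + ⟪u, (u·∇)ψ⟫ + ν⟪u, Δψ⟫) dx dt = 0` (Leray 1934, §III (17); KNSS 2009, §4 (ii)):
the pressure drops out against divergence-free fields, so neither a growth condition on `p` nor
boundedness of `u` is needed. Word for word the proof of the accepted
`IsClassicalNSSolutionOn.isBoundedWeakNSSolutionOn` (which uses its boundedness hypothesis only
for the `L^∞` clause of KNSS's class): the slice identity `∫⟪∂ₜu, ψ⟫ = ∫⟪u, (u·∇)ψ⟫ + ν∫⟪u, Δψ⟫`
(`integral_inner_timeDerivWithin_test`) integrated over a compact time interval containing the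
time support of `ψ`. [cite: KochNadirashviliSereginSverak2009, §4 (ii) (arXiv:0709.3599 p. 8)] -/
theorem IsClassicalNSSolutionOn.integral_veryWeak_eq_zero {a b ν : ℝ} {u : ℝ → E → E}
    {p : ℝ → E → ℝ} (h : IsClassicalNSSolutionOn (Ioo a b) ν 0 u p) {ψ : ℝ → E → E}
    (hψ : IsSpaceTimeTestOn (slab E (Ioo a b) isOpen_Ioo) ψ)
    (hdiv : ∀ t, VectorCalculus.IsDivFree (ψ t)) :
    ∫ t in Ioo a b, ∫ x, (⟪u t x, timeDeriv ψ t x⟫ + ⟪u t x, convect (u t) (ψ t) x⟫ +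
        ν * ⟪u t x, Δ (ψ t) x⟫) = 0 := by
  rcases le_or_gt b a with hab | hab
  · simp [Ioo_eq_empty_of_le hab]
  -- time support `[a', b'] ⊂ (a, b)` and a compact interval `[a₁, b₁]` around it
  obtain ⟨a', b', haa', ha'b', hb'b, hsupp⟩ := hψ.exists_time_support_Ioo hab
  set a₁ : ℝ := (a + a') / 2 with ha₁
  set b₁ : ℝ := (b' + b) / 2 with hb₁
  have haa₁ : a < a₁ := by rw [ha₁]; linarith
  have ha₁a' : a₁ < a' := by rw [ha₁]; linarith
  have hb'b₁ : b' < b₁ := by rw [hb₁]; linarith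
  have hb₁b : b₁ < b := by rw [hb₁]; linarith
  have ha₁b₁ : a₁ < b₁ := by linarith
  have hsub : Icc a₁ b₁ ⊆ Ioo a b := fun t ht => ⟨haa₁.trans_le ht.1, ht.2.trans_lt hb₁b⟩
  set S₀ : Set ℝ := Icc a₁ b₁ with hS₀
  have hU : UniqueDiffOn ℝ S₀ := uniqueDiffOn_Icc ha₁b₁
  have h₀ : IsClassicalNSSolutionOn S₀ ν 0 u p := h.mono hsub hU
  have hu₀ : ContinuousOn (uncurry u) (S₀ ×ˢ univ) := h₀.smooth_velocity.continuousOn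
  have hdt_cont : ContinuousOn (uncurry (timeDerivWithin S₀ u)) (S₀ ×ˢ univ) :=
    (h₀.smooth_velocity.timeDerivWithin hU).continuousOn
  -- values of `ψ` and its derived fields off the time support
  have hψ0 : ∀ t, t ∉ Icc a' b' → ∀ x, ψ t x = 0 := fun t ht x => by rw [hsupp t ht]; rfl
  have hψa₁ : ∀ x, ψ a₁ x = 0 := hψ0 a₁ fun ht => (not_le.2 ha₁a') ht.1
  have hψb₁ : ∀ x, ψ b₁ x = 0 := hψ0 b₁ fun ht => (not_le.2 hb'b₁) ht.2
  have hzero : ∀ t, t ∉ Icc a' b' → ∀ x,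
      ⟪u t x, timeDeriv ψ t x⟫ + ⟪u t x, convect (u t) (ψ t) x⟫ + ν * ⟪u t x, Δ (ψ t) x⟫ = 0 := by
    intro t ht x
    have hopen : IsOpen (Icc a' b')ᶜ := isClosed_Icc.isOpen_compl
    have hnear : (fun s => ψ s x) =ᶠ[𝓝 t] fun _ => (0 : E) :=
      Filter.eventually_of_mem (hopen.mem_nhds ht) fun s hs => hψ0 s hs x
    have h1 : timeDeriv ψ t x = 0 := by
      rw [timeDeriv_apply, hnear.deriv_eq, deriv_const]
    have h2 : fderiv ℝ (ψ t) x = 0 := by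
      rw [show ψ t = fun _ => (0 : E) from funext (hψ0 t ht), fderiv_fun_const, Pi.zero_apply]
    have h3 : Δ (ψ t) x = 0 :=
      laplacian_eq_zero_of_notMem_tsupport (by
        rw [hsupp t ht, tsupport_eq_empty_iff.2 rfl]; exact notMem_empty x)
    rw [h1, convect_apply, h2, h3]
    simp
  -- reduce the time integral to `(a₁, b₁)`
  rw [setIntegral_eq_of_subset_of_forall_sdiff_eq_zero (measurableSet_Ioo (a := a) (b := b))
    (Ioo_subset_Ioo haa₁.le hb₁b.le : Ioo a₁ b₁ ⊆ Ioo a b)]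
  swap
  · intro t ht
    have ht' : t ∉ Icc a' b' := fun h' => ht.2 ⟨ha₁a'.trans_le h'.1, h'.2.trans_lt hb'b₁⟩
    simp only [hzero t ht', integral_zero]
  -- the compact `x`-shadow of the test field
  obtain ⟨K, hK, hKt⟩ := hψ.exists_compact_slice_subset
  have hψK : ∀ t, ∀ x ∉ K, ψ t x = 0 := fun t x hx =>
    image_eq_zero_of_notMem_tsupport fun h' => hx (hKt t h')
  -- the space–time integrand `∂ₜ ⟪u, ψ⟫`
  set D : ℝ × E → ℝ := fun z => ⟪u z.1 z.2, timeDeriv ψ z.1 z.2⟫ +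
    ⟪timeDerivWithin S₀ u z.1 z.2, ψ z.1 z.2⟫ with hD
  have hDcont : ContinuousOn D (Icc a₁ b₁ ×ˢ univ) := by
    refine ContinuousOn.add (ContinuousOn.inner hu₀ hψ.continuous_timeDeriv.continuousOn)
      (ContinuousOn.inner hdt_cont ?_)
    exact hψ.contDiff.continuous.continuousOn
  have hDK : ∀ t ∈ Icc a₁ b₁, ∀ x ∉ K, D (t, x) = 0 := fun t _ x hx => by
    simp only [hD]
    rw [hψK t x hx, timeDeriv_eq_zero_of_forall (fun s => hψK s x hx)]
    simp
  have hDint := integrable_prod_of_continuousOn hK hDcont hDK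
  -- slice identity for every `t ∈ (a₁, b₁)`
  have hslice : ∀ t ∈ Ioo a₁ b₁, ∫ x, (⟪u t x, timeDeriv ψ t x⟫ + ⟪u t x, convect (u t) (ψ t) x⟫ +
      ν * ⟪u t x, (Δ (ψ t)) x⟫) = ∫ x, D (t, x) := by
    intro t ht
    have ht' : t ∈ S₀ := Ioo_subset_Icc_self ht
    have hψ2 : ContDiff ℝ 2 (ψ t) := contDiff_infty.1 (hψ.contDiff_slice t) 2
    have key := h₀.integral_inner_timeDerivWithin_test hU ht' hψ2 (hψ.hasCompactSupport_slice t)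
      (hdiv t)
    simp only [Pi.zero_apply, inner_zero_left, add_zero] at key
    have huc : Continuous (u t) := (h₀.contDiff_velocity ht').continuous
    have i1 : Integrable (fun x => ⟪u t x, timeDeriv ψ t x⟫) (volume : Measure E) :=
      integrable_inner_of_hasCompactSupport_right huc
        (hψ.continuous_timeDeriv.comp (Continuous.prodMk_right t))
        (HasCompactSupport.intro hK fun x hx => timeDeriv_eq_zero_of_forall
          (fun s => hψK s x hx) t)
    have i2 : Integrable (fun x => ⟪timeDerivWithin S₀ u t x, ψ t x⟫) (volume : Measure E) :=
      integrable_inner_of_hasCompactSupport_right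
        (((h₀.smooth_velocity.timeDerivWithin hU).contDiff_slice ht').continuous)
        (hψ.contDiff_slice t).continuous (hψ.hasCompactSupport_slice t)
    have hψ1 : ContDiff ℝ 1 (ψ t) := hψ2.of_le one_le_two
    have iC' : Integrable (fun x => ⟪u t x, convect (u t) (ψ t) x⟫) (volume : Measure E) :=
      integrable_inner_of_hasCompactSupport_right huc
        ((hψ1.continuous_fderiv one_ne_zero).clm_apply huc)
        (((hψ.hasCompactSupport_slice t).fderiv (𝕜 := ℝ)).mono fun x hx => by
          contrapose! hx; simp only [mem_support, not_not] at hx; simp [convect, hx])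
    have iL' : Integrable (fun x => ν * ⟪u t x, (Δ (ψ t)) x⟫) (volume : Measure E) :=
      (integrable_inner_of_hasCompactSupport_right huc (continuous_laplacian hψ2)
        ((hψ.hasCompactSupport_slice t).mono' fun x hx => by
          contrapose! hx; simp [laplacian_eq_zero_of_notMem_tsupport hx])).const_mul ν
    calc ∫ x, (⟪u t x, timeDeriv ψ t x⟫ + ⟪u t x, convect (u t) (ψ t) x⟫ +
          ν * ⟪u t x, (Δ (ψ t)) x⟫)
        = ∫ x, (⟪u t x, timeDeriv ψ t x⟫ + (⟪u t x, convect (u t) (ψ t) x⟫ +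
          ν * ⟪u t x, (Δ (ψ t)) x⟫)) :=
          integral_congr_ae (Eventually.of_forall fun x => by ring)
      _ = (∫ x, ⟪u t x, timeDeriv ψ t x⟫) + ∫ x, ⟪timeDerivWithin S₀ u t x, ψ t x⟫ := by
          have i3 : Integrable (fun x => ⟪u t x, convect (u t) (ψ t) x⟫ +
              ν * ⟪u t x, (Δ (ψ t)) x⟫) (volume : Measure E) := iC'.add iL'
          rw [integral_add i1 i3, key]
      _ = ∫ x, D (t, x) := (integral_add i1 i2).symm
  -- integrate the slice identity in time and swap the integrals
  have hstep : ∫ t in Ioo a₁ b₁, ∫ x, (⟪u t x, timeDeriv ψ t x⟫ + ⟪u t x, convect (u t) (ψ t) x⟫ +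
      ν * ⟪u t x, (Δ (ψ t)) x⟫) = ∫ x, ∫ t in Ioo a₁ b₁, D (t, x) := by
    rw [setIntegral_congr_fun measurableSet_Ioo hslice]
    exact integral_integral_swap (f := fun t x => D (t, x)) hDint
  -- fundamental theorem of calculus on each time line: both boundary terms vanish
  have hline : ∀ x, ∫ t in Ioo a₁ b₁, D (t, x) = 0 := by
    intro x
    have hcont : ContinuousOn (fun t => ⟪u t x, ψ t x⟫) (Icc a₁ b₁) := by
      refine ContinuousOn.inner ?_ ?_
      · exact hu₀.comp (Continuous.prodMk_left x).continuousOn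
          fun t ht => mk_mem_prod ht (mem_univ x)
      · exact (hψ.contDiff.continuous.comp (Continuous.prodMk_left x)).continuousOn
    have hderiv : ∀ t ∈ Ioo a₁ b₁, HasDerivWithinAt (fun t => ⟪u t x, ψ t x⟫) (D (t, x))
        (Ioi t) t := by
      intro t ht
      have hu' : HasDerivAt (fun s => u s x) (timeDerivWithin S₀ u t x) t :=
        (h₀.smooth_velocity.hasDerivWithinAt_timeDerivWithin hU (Ioo_subset_Icc_self ht)
          x).hasDerivAt (Icc_mem_nhds ht.1 ht.2)
      exact (hu'.inner ℝ (hψ.hasDerivAt_time t x)).hasDerivWithinAt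
    have hint : IntervalIntegrable (fun t => D (t, x)) volume a₁ b₁ := by
      refine ContinuousOn.intervalIntegrable ?_
      rw [uIcc_of_le ha₁b₁.le]
      exact hDcont.comp (Continuous.prodMk_left x).continuousOn
        fun t ht => mk_mem_prod ht (mem_univ x)
    have := intervalIntegral.integral_eq_sub_of_hasDeriv_right_of_le ha₁b₁.le hcont hderiv hint
    rw [intervalIntegral.integral_of_le ha₁b₁.le, integral_Ioc_eq_integral_Ioo] at this
    rw [this, hψa₁ x, hψb₁ x, inner_zero_right, inner_zero_right, sub_self]
  rw [hstep, integral_congr_ae (Eventually.of_forall hline), integral_zero]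

/-- The slices of a classical solution are weakly divergence free (they are `C¹` and
divergence free; the accepted `VectorCalculus.IsDivFree.isWeaklyDivFree_holds`). [folklore] -/
theorem IsClassicalNSSolutionOn.isWeaklyDivFree_slice {S : Set ℝ} {ν : ℝ} {f u : ℝ → E → E}
    {p : ℝ → E → ℝ} (h : IsClassicalNSSolutionOn S ν f u p) {t : ℝ} (ht : t ∈ S) :
    IsWeaklyDivFree (u t) :=
  VectorCalculus.IsDivFree.isWeaklyDivFree_holds (h.divFree t ht)
    (contDiff_infty.1 (h.contDiff_velocity ht) 1)

end VeryWeak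

/-! ### The rescaled and translated solutions -/

section Rescaled

variable {T : ℝ} {z : EuclideanSpace ℝ (Fin 3)}
  {v : ℝ → EuclideanSpace ℝ (Fin 3) → EuclideanSpace ℝ (Fin 3)} {π : ℝ → EuclideanSpace ℝ (Fin 3) → ℝ}

/-- **The blow-up rescalings are classical solutions** (Chae 2007, proof of Thm 1.5, the fields
`V(·, s)` of (3.13); Leray's similarity covariance): for a classical solution `(v, π)` of
Navier–Stokes (`ν = 1`, `f = 0`) on `(0, T)` and `0 < c` with `c² ≤ T`, the rescaling
`v_c = nsRescale c (v(T + ·, z + ·))` about `(T, z)` (`v_c(s, y) = c v(T + c²s, z + cy)`) is,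
with the pressure `c² π(T + c²s, z + cy)`, a classical solution on the time interval `(−1, 0)`
(the accepted `IsClassicalNSSolutionOn.nsRescale_translate_zero`, restricted from
`(−T/c², 0)`). [cite: Chae2007, proof of Thm 1.5, (3.13) (arXiv p. 8)] -/
theorem IsClassicalNSSolutionOn.nsRescale_blowup (hv : IsClassicalNSSolutionOn (Ioo 0 T) 1 0 v π)
    {c : ℝ} (hc : 0 < c) (hcT : c ^ 2 ≤ T) :
    IsClassicalNSSolutionOn (Ioo (-1) 0) 1 0 (FluidPDE.nsRescale c fun τ x => v (T + τ) (z + x))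
      (c ^ 2 • stPull (c ^ 2) c T z π) := by
  have key := hv.nsRescale_translate_zero hc T z
  have hu : (c • stPull (c ^ 2) c T z v) = FluidPDE.nsRescale c fun τ x => v (T + τ) (z + x) := by
    funext s y
    simp [stPull_apply, nsRescale_apply]
  rw [hu] at key
  refine key.mono (fun s hs => ?_) (uniqueDiffOn_Ioo (-1) 0)
  simp only [mem_preimage, mem_Ioo] at hs ⊢
  have hc2 : 0 < c ^ 2 := by positivity
  constructor <;> nlinarith [hs.1, hs.2]

end Rescaled



section TestBounds

variable {E : Type*} [NormedAddCommGroup E] [InnerProductSpace ℝ E] [FiniteDimensional ℝ E]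
variable {F : Type*} [NormedAddCommGroup F] [InnerProductSpace ℝ F]

/-- Off the support of a space–time field `ψ`, its time derivative, slice derivative and slice
Laplacian vanish (`ψ` vanishes on a neighbourhood of the point). [folklore] -/
theorem derived_eq_zero_of_notMem_tsupport {ψ : ℝ → E → F}
    {t : ℝ} {x : E} (h : (t, x) ∉ tsupport (uncurry ψ)) :
    timeDeriv ψ t x = 0 ∧ fderiv ℝ (ψ t) x = 0 ∧ Δ (ψ t) x = 0 := by
  have h0 : uncurry ψ =ᶠ[𝓝 (t, x)] 0 := notMem_tsupport_iff_eventuallyEq.1 h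
  have h1 : (fun s => ψ s x) =ᶠ[𝓝 t] fun _ => (0 : F) :=
    ((Continuous.prodMk_left x).tendsto t).eventually h0
  have h2 : ψ t =ᶠ[𝓝 x] fun _ => (0 : F) :=
    ((Continuous.prodMk_right t).tendsto x).eventually h0
  have hx : x ∉ tsupport (ψ t) := notMem_tsupport_iff_eventuallyEq.2 h2
  refine ⟨?_, ?_, laplacian_eq_zero_of_notMem_tsupport hx⟩
  · rw [timeDeriv_apply, h1.deriv_eq, deriv_const]
  · exact fderiv_of_notMem_tsupport ℝ hx

/-- **Uniform bounds for the derived fields of a test field**: for a space–time test field `ψ`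
there is `M ≥ 0` bounding `‖∂ₜψ‖`, `‖Dₓψ‖` and `‖Δψ‖` everywhere (each is continuous with compact
support). [folklore] -/
theorem IsSpaceTimeTestOn.exists_uniform_bound {Q : Opens (ℝ × E)} {ψ : ℝ → E → F}
    (hψ : IsSpaceTimeTestOn Q ψ) :
    ∃ M : ℝ, 0 ≤ M ∧ ∀ t x, ‖timeDeriv ψ t x‖ ≤ M ∧ ‖fderiv ℝ (ψ t) x‖ ≤ M ∧ ‖Δ (ψ t) x‖ ≤ M := by
  have hK : IsCompact (tsupport (uncurry ψ)) := hψ.hasCompactSupport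
  have c1 : Continuous (uncurry (timeDeriv ψ)) := hψ.continuous_timeDeriv
  have c2 : Continuous fun z : ℝ × E => fderiv ℝ (ψ z.1) z.2 := by
    have := ((hψ.isSmoothSpaceTimeOn univ).fderiv_slice uniqueDiffOn_univ).continuousOn
    rwa [univ_prod_univ, continuousOn_univ] at this
  have c3 : Continuous fun z : ℝ × E => Δ (ψ z.1) z.2 := by
    have := ((hψ.isSmoothSpaceTimeOn univ).laplacian uniqueDiffOn_univ).continuousOn
    rwa [univ_prod_univ, continuousOn_univ] at this
  have s1 : HasCompactSupport (uncurry (timeDeriv ψ)) :=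
    HasCompactSupport.intro hK fun z hz => (derived_eq_zero_of_notMem_tsupport hz).1
  have s2 : HasCompactSupport fun z : ℝ × E => fderiv ℝ (ψ z.1) z.2 :=
    HasCompactSupport.intro hK fun z hz => (derived_eq_zero_of_notMem_tsupport hz).2.1
  have s3 : HasCompactSupport fun z : ℝ × E => Δ (ψ z.1) z.2 :=
    HasCompactSupport.intro hK fun z hz => (derived_eq_zero_of_notMem_tsupport hz).2.2
  obtain ⟨M₁, hM₁⟩ := c1.bounded_above_of_compact_support s1
  obtain ⟨M₂, hM₂⟩ := c2.bounded_above_of_compact_support s2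
  obtain ⟨M₃, hM₃⟩ := c3.bounded_above_of_compact_support s3
  refine ⟨max (max M₁ M₂) (max M₃ 0), le_max_of_le_right (le_max_right _ _), fun t x => ⟨?_, ?_, ?_⟩⟩
  · exact (hM₁ (t, x)).trans (le_max_of_le_left (le_max_left _ _))
  · exact (hM₂ (t, x)).trans (le_max_of_le_left (le_max_right _ _))
  · exact (hM₃ (t, x)).trans (le_max_of_le_right (le_max_left _ _))

end TestBounds

section SliceEstimates

variable {α : Type*} [MeasurableSpace α] {μ : Measure α}
variable {F : Type*} [NormedAddCommGroup F]

/-- Cauchy–Schwarz in the form `∫⁻ ‖f‖ₑ g ≤ ‖f‖_{L²} (∫⁻ g²)^{1/2}` (Mathlib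
`ENNReal.lintegral_mul_le_Lp_mul_Lq` with `p = q = 2`). [folklore] -/
theorem lintegral_enorm_mul_le_eLpNorm_two {f : α → F} {g : α → ℝ≥0∞}
    (hf : AEStronglyMeasurable f μ) (hg : AEMeasurable g μ) :
    ∫⁻ x, ‖f x‖ₑ * g x ∂μ ≤ eLpNorm f 2 μ * (∫⁻ x, g x ^ (2 : ℝ) ∂μ) ^ (1 / 2 : ℝ) := by
  have h := ENNReal.lintegral_mul_le_Lp_mul_Lq μ Real.HolderConjugate.two_two hf.enorm hg
  rw [eLpNorm_eq_lintegral_rpow_enorm_toReal two_ne_zero ENNReal.ofNat_ne_top]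
  simpa using h

/-- `‖f‖_{L²(μ)} ≤ μ(univ)^{1/2 − 1/q} ‖f‖_{L^q(μ)}` for `q ≥ 2` (Hölder; Mathlib
`eLpNorm_le_eLpNorm_mul_rpow_measure_univ`). [folklore] -/
theorem eLpNorm_two_le_mul_eLpNorm {f : α → F} {q : ℝ≥0∞} (hq : 2 ≤ q)
    (hf : AEStronglyMeasurable f μ) :
    eLpNorm f 2 μ ≤ μ univ ^ (1 / (2 : ℝ) - 1 / q.toReal) * eLpNorm f q μ := by
  have h := eLpNorm_le_eLpNorm_mul_rpow_measure_univ hq hf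
  rw [mul_comm] at h
  simpa using h

/-- `∫⁻ ‖f‖ₑ dμ ≤ μ(univ)^{1/2} ‖f‖_{L²(μ)}` (Cauchy–Schwarz against `1`). [folklore] -/
theorem lintegral_enorm_le_mul_eLpNorm_two {f : α → F} (hf : AEStronglyMeasurable f μ) :
    ∫⁻ x, ‖f x‖ₑ ∂μ ≤ μ univ ^ (1 / (2 : ℝ)) * eLpNorm f 2 μ := by
  have h := eLpNorm_le_eLpNorm_mul_rpow_measure_univ (p := 1) (q := 2) (by norm_num) hf
  rw [eLpNorm_one_eq_lintegral_enorm, mul_comm] at h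
  refine h.trans (le_of_eq ?_)
  norm_num

end SliceEstimates


section Pointwise

variable {F : Type*} [NormedAddCommGroup F] [InnerProductSpace ℝ F]

/-- **Pointwise estimate for the very weak integrand.** With test data `d`, `D`, `L` of norm
`≤ M`, the integrand `F(a) = ⟪a, d⟫ + ⟪a, D a⟫ + ν⟪a, L⟫` satisfies
`|F(a) − F(b)| ≤ M ‖a − b‖ (1 + |ν| + ‖a − b‖ + 2‖b‖)`
(`F(a) − F(b) = ⟪a−b, d⟫ + ⟪a−b, D a⟫ + ⟪b, D(a−b)⟫ + ν⟪a−b, L⟫` and `‖a‖ ≤ ‖a−b‖ + ‖b‖`). [folklore] -/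
theorem norm_veryWeakIntegrand_sub_le {a b d L : F} {D : F →L[ℝ] F} {M ν : ℝ}
    (h1 : ‖d‖ ≤ M) (h2 : ‖D‖ ≤ M) (h3 : ‖L‖ ≤ M) :
    ‖(⟪a, d⟫ + ⟪a, D a⟫ + ν * ⟪a, L⟫) - (⟪b, d⟫ + ⟪b, D b⟫ + ν * ⟪b, L⟫)‖ ≤
      M * ‖a - b‖ * (1 + |ν| + ‖a - b‖ + 2 * ‖b‖) := by
  have hM : 0 ≤ M := (norm_nonneg _).trans h1
  have key : (⟪a, d⟫ + ⟪a, D a⟫ + ν * ⟪a, L⟫) - (⟪b, d⟫ + ⟪b, D b⟫ + ν * ⟪b, L⟫) =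
      ⟪a - b, d⟫ + ⟪a - b, D a⟫ + ⟪b, D (a - b)⟫ + ν * ⟪a - b, L⟫ := by
    simp only [inner_sub_left, map_sub, inner_sub_right]
    ring
  rw [key]
  have e1 : ‖⟪a - b, d⟫‖ ≤ ‖a - b‖ * M :=
    (norm_inner_le_norm _ _).trans (mul_le_mul_of_nonneg_left h1 (norm_nonneg _))
  have e2 : ‖⟪a - b, D a⟫‖ ≤ ‖a - b‖ * (M * (‖a - b‖ + ‖b‖)) := by
    refine (norm_inner_le_norm _ _).trans (mul_le_mul_of_nonneg_left ?_ (norm_nonneg _))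
    refine (D.le_opNorm a).trans (mul_le_mul h2 ?_ (norm_nonneg _) hM)
    calc ‖a‖ = ‖(a - b) + b‖ := by rw [sub_add_cancel]
      _ ≤ ‖a - b‖ + ‖b‖ := norm_add_le _ _
  have e3 : ‖⟪b, D (a - b)⟫‖ ≤ ‖b‖ * (M * ‖a - b‖) := by
    refine (norm_inner_le_norm _ _).trans (mul_le_mul_of_nonneg_left ?_ (norm_nonneg _))
    exact (D.le_opNorm _).trans (mul_le_mul_of_nonneg_right h2 (norm_nonneg _))
  have e4 : ‖ν * ⟪a - b, L⟫‖ ≤ |ν| * (‖a - b‖ * M) := by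
    rw [norm_mul, Real.norm_eq_abs]
    exact mul_le_mul_of_nonneg_left
      ((norm_inner_le_norm _ _).trans (mul_le_mul_of_nonneg_left h3 (norm_nonneg _))) (abs_nonneg _)
  calc ‖⟪a - b, d⟫ + ⟪a - b, D a⟫ + ⟪b, D (a - b)⟫ + ν * ⟪a - b, L⟫‖
      ≤ ‖⟪a - b, d⟫‖ + ‖⟪a - b, D a⟫‖ + ‖⟪b, D (a - b)⟫‖ + ‖ν * ⟪a - b, L⟫‖ := by
        refine (norm_add_le _ _).trans (add_le_add ((norm_add_le _ _).trans
          (add_le_add (norm_add_le _ _) le_rfl)) le_rfl)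
    _ ≤ ‖a - b‖ * M + ‖a - b‖ * (M * (‖a - b‖ + ‖b‖)) + ‖b‖ * (M * ‖a - b‖) +
        |ν| * (‖a - b‖ * M) := add_le_add (add_le_add (add_le_add e1 e2) e3) e4
    _ = M * ‖a - b‖ * (1 + |ν| + ‖a - b‖ + 2 * ‖b‖) := by ring

/-- The case `b = 0` of `norm_veryWeakIntegrand_sub_le`:
`|⟪a, d⟫ + ⟪a, D a⟫ + ν⟪a, L⟫| ≤ M ‖a‖ (1 + |ν| + ‖a‖)`. [folklore] -/
theorem norm_veryWeakIntegrand_le {a d L : F} {D : F →L[ℝ] F} {M ν : ℝ}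
    (h1 : ‖d‖ ≤ M) (h2 : ‖D‖ ≤ M) (h3 : ‖L‖ ≤ M) :
    ‖⟪a, d⟫ + ⟪a, D a⟫ + ν * ⟪a, L⟫‖ ≤ M * ‖a‖ * (1 + |ν| + ‖a‖) := by
  have h := norm_veryWeakIntegrand_sub_le (a := a) (b := 0) (ν := ν) h1 h2 h3
  simpa using h

end Pointwise

section Slice

variable {α : Type*} [MeasurableSpace α] {μ : Measure α}
variable {F : Type*} [NormedAddCommGroup F] [InnerProductSpace ℝ F]

omit [InnerProductSpace ℝ F] in
/-- `(∫⁻ ‖f‖ₑ²)^{1/2} = ‖f‖_{L²}` (unfolding `eLpNorm`). [folklore] -/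
theorem lintegral_enorm_sq_rpow_half_eq (f : α → F) (μ : Measure α) :
    (∫⁻ x, ‖f x‖ₑ ^ (2 : ℝ) ∂μ) ^ (1 / 2 : ℝ) = eLpNorm f 2 μ := by
  rw [eLpNorm_eq_lintegral_rpow_enorm_toReal two_ne_zero ENNReal.ofNat_ne_top]
  norm_num

/-- **Slice estimate for the very weak integrand.** With test data `d`, `D`, `L` of norm `≤ M`
vanishing off a set `s`, and `Φ(u)(x) = ⟪u x, d x⟫ + ⟪u x, D x (u x)⟫ + ν⟪u x, L x⟫`, for
measurable fields `a`, `b`: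
`∫⁻ ‖Φ(a) − Φ(b)‖ₑ ≤ M ‖a−b‖_{L²(s)} ((1+|ν|) μ(s)^{1/2} + ‖a−b‖_{L²(s)} + 2‖b‖_{L²(s)})`
(the pointwise bound `norm_veryWeakIntegrand_sub_le` integrated over `s`, Cauchy–Schwarz). [folklore] -/
theorem lintegral_veryWeakIntegrand_sub_le {a b d L : α → F} {D : α → F →L[ℝ] F} {M ν : ℝ}
    {s : Set α} (hM : ∀ x, ‖d x‖ ≤ M ∧ ‖D x‖ ≤ M ∧ ‖L x‖ ≤ M)
    (hs : ∀ x ∉ s, d x = 0 ∧ D x = 0 ∧ L x = 0)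
    (ha : AEStronglyMeasurable a μ) (hb : AEStronglyMeasurable b μ) :
    ∫⁻ x, ‖(⟪a x, d x⟫ + ⟪a x, D x (a x)⟫ + ν * ⟪a x, L x⟫) -
        (⟪b x, d x⟫ + ⟪b x, D x (b x)⟫ + ν * ⟪b x, L x⟫)‖ₑ ∂μ ≤
      ENNReal.ofReal M * eLpNorm (a - b) 2 (μ.restrict s) *
        (ENNReal.ofReal (1 + |ν|) * μ s ^ (1 / 2 : ℝ) + eLpNorm (a - b) 2 (μ.restrict s) +
          2 * eLpNorm b 2 (μ.restrict s)) := by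
  set Φ : (α → F) → α → ℝ := fun u x => ⟪u x, d x⟫ + ⟪u x, D x (u x)⟫ + ν * ⟪u x, L x⟫ with hΦ
  show ∫⁻ x, ‖Φ a x - Φ b x‖ₑ ∂μ ≤ _
  -- restrict to `s`
  have hsupp : (fun x => ‖Φ a x - Φ b x‖ₑ).support ⊆ s := by
    intro x hx
    by_contra hxs
    obtain ⟨h1, h2, h3⟩ := hs x hxs
    simp [hΦ, h1, h2, h3] at hx
  rw [← setLIntegral_eq_of_support_subset hsupp]
  -- pointwise bound
  set δ : α → F := a - b with hδ
  have hδx : ∀ x, δ x = a x - b x := fun x => rfl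
  have hpt : ∀ x, ‖Φ a x - Φ b x‖ₑ ≤ ENNReal.ofReal M *
      (ENNReal.ofReal (1 + |ν|) * ‖δ x‖ₑ + ‖δ x‖ₑ * ‖δ x‖ₑ + 2 * (‖δ x‖ₑ * ‖b x‖ₑ)) := by
    intro x
    obtain ⟨h1, h2, h3⟩ := hM x
    have hM0 : 0 ≤ M := (norm_nonneg _).trans h1
    have key := norm_veryWeakIntegrand_sub_le (a := a x) (b := b x) (ν := ν) h1 h2 h3
    rw [← ofReal_norm, ← ofReal_norm (δ x), ← ofReal_norm (b x), hδx]
    have hν : 0 ≤ 1 + |ν| := by positivity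
    calc ENNReal.ofReal ‖Φ a x - Φ b x‖
        ≤ ENNReal.ofReal (M * ‖a x - b x‖ * (1 + |ν| + ‖a x - b x‖ + 2 * ‖b x‖)) :=
          ENNReal.ofReal_le_ofReal key
      _ = ENNReal.ofReal M * (ENNReal.ofReal (1 + |ν|) * ENNReal.ofReal ‖a x - b x‖ +
            ENNReal.ofReal ‖a x - b x‖ * ENNReal.ofReal ‖a x - b x‖ +
            2 * (ENNReal.ofReal ‖a x - b x‖ * ENNReal.ofReal ‖b x‖)) := by
          rw [show M * ‖a x - b x‖ * (1 + |ν| + ‖a x - b x‖ + 2 * ‖b x‖) =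
              M * ((1 + |ν|) * ‖a x - b x‖ + ‖a x - b x‖ * ‖a x - b x‖ +
                2 * (‖a x - b x‖ * ‖b x‖)) by ring]
          rw [ENNReal.ofReal_mul hM0, ENNReal.ofReal_add (by positivity) (by positivity),
            ENNReal.ofReal_add (by positivity) (by positivity), ENNReal.ofReal_mul hν,
            ENNReal.ofReal_mul (norm_nonneg _), ENNReal.ofReal_mul zero_le_two,
            ENNReal.ofReal_mul (norm_nonneg _), ENNReal.ofReal_ofNat]
  -- measurability
  have hδm : AEStronglyMeasurable δ (μ.restrict s) := (ha.sub hb).restrict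
  have hbm : AEStronglyMeasurable b (μ.restrict s) := hb.restrict
  have hδe : AEMeasurable (fun x => ‖δ x‖ₑ) (μ.restrict s) := hδm.enorm
  have hbe : AEMeasurable (fun x => ‖b x‖ₑ) (μ.restrict s) := hbm.enorm
  -- integrate
  have hMtop : ENNReal.ofReal M ≠ (⊤ : ℝ≥0∞) := ENNReal.ofReal_ne_top
  calc ∫⁻ x in s, ‖Φ a x - Φ b x‖ₑ ∂μ
      ≤ ∫⁻ x in s, ENNReal.ofReal M *
          (ENNReal.ofReal (1 + |ν|) * ‖δ x‖ₑ + ‖δ x‖ₑ * ‖δ x‖ₑ + 2 * (‖δ x‖ₑ * ‖b x‖ₑ)) ∂μ :=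
        lintegral_mono fun x => hpt x
    _ = ENNReal.ofReal M * (ENNReal.ofReal (1 + |ν|) * ∫⁻ x in s, ‖δ x‖ₑ ∂μ +
          ∫⁻ x in s, ‖δ x‖ₑ * ‖δ x‖ₑ ∂μ + 2 * ∫⁻ x in s, ‖δ x‖ₑ * ‖b x‖ₑ ∂μ) := by
        have m1 : AEMeasurable (fun x => ENNReal.ofReal (1 + |ν|) * ‖δ x‖ₑ + ‖δ x‖ₑ * ‖δ x‖ₑ)
            (μ.restrict s) := (hδe.const_mul _).add (hδe.mul hδe)
        have m2 : AEMeasurable (fun x => ENNReal.ofReal (1 + |ν|) * ‖δ x‖ₑ) (μ.restrict s) :=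
          hδe.const_mul _
        rw [lintegral_const_mul' _ _ hMtop, lintegral_add_left' m1, lintegral_add_left' m2,
          lintegral_const_mul' _ _ ENNReal.ofReal_ne_top,
          lintegral_const_mul' _ (fun x => ‖δ x‖ₑ * ‖b x‖ₑ) ENNReal.ofNat_ne_top]
    _ ≤ ENNReal.ofReal M * (ENNReal.ofReal (1 + |ν|) * (μ s ^ (1 / 2 : ℝ) * eLpNorm δ 2 (μ.restrict s)) +
          eLpNorm δ 2 (μ.restrict s) * eLpNorm δ 2 (μ.restrict s) +
          2 * (eLpNorm δ 2 (μ.restrict s) * eLpNorm b 2 (μ.restrict s))) := by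
        gcongr
        · simpa only [Measure.restrict_apply_univ] using lintegral_enorm_le_mul_eLpNorm_two hδm
        · calc ∫⁻ x in s, ‖δ x‖ₑ * ‖δ x‖ₑ ∂μ
              ≤ eLpNorm δ 2 (μ.restrict s) * (∫⁻ x in s, ‖δ x‖ₑ ^ (2 : ℝ) ∂μ) ^ (1 / 2 : ℝ) :=
                lintegral_enorm_mul_le_eLpNorm_two hδm hδe
            _ = _ := by rw [lintegral_enorm_sq_rpow_half_eq]
        · calc ∫⁻ x in s, ‖δ x‖ₑ * ‖b x‖ₑ ∂μ
              ≤ eLpNorm δ 2 (μ.restrict s) * (∫⁻ x in s, ‖b x‖ₑ ^ (2 : ℝ) ∂μ) ^ (1 / 2 : ℝ) :=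
                lintegral_enorm_mul_le_eLpNorm_two hδm hbe
            _ = _ := by rw [lintegral_enorm_sq_rpow_half_eq]
    _ = _ := by rw [hδ]; ring

/-- The case `b = 0` of `lintegral_veryWeakIntegrand_sub_le`:
`∫⁻ ‖Φ(a)‖ₑ ≤ M ‖a‖_{L²(s)} ((1+|ν|) μ(s)^{1/2} + ‖a‖_{L²(s)})`. [folklore] -/
theorem lintegral_veryWeakIntegrand_le {a d L : α → F} {D : α → F →L[ℝ] F} {M ν : ℝ}
    {s : Set α} (hM : ∀ x, ‖d x‖ ≤ M ∧ ‖D x‖ ≤ M ∧ ‖L x‖ ≤ M)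
    (hs : ∀ x ∉ s, d x = 0 ∧ D x = 0 ∧ L x = 0) (ha : AEStronglyMeasurable a μ) :
    ∫⁻ x, ‖⟪a x, d x⟫ + ⟪a x, D x (a x)⟫ + ν * ⟪a x, L x⟫‖ₑ ∂μ ≤
      ENNReal.ofReal M * eLpNorm a 2 (μ.restrict s) *
        (ENNReal.ofReal (1 + |ν|) * μ s ^ (1 / 2 : ℝ) + eLpNorm a 2 (μ.restrict s)) := by
  have h := lintegral_veryWeakIntegrand_sub_le (b := fun _ => (0 : F)) (ν := ν) hM hs ha
    aestronglyMeasurable_const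
  simp only [inner_zero_left, map_zero, mul_zero, add_zero, sub_zero] at h
  have h0 : (a - fun _ => (0 : F)) = a := by funext x; simp
  rw [h0] at h
  simpa using h

end Slice

section Limit

variable {E : Type*} [NormedAddCommGroup E] [InnerProductSpace ℝ E] [FiniteDimensional ℝ E]
  [MeasurableSpace E] [BorelSpace E]

/-- Measurability of the slice `x ↦ ⟪a x, d x⟫ + ⟪a x, D x (a x)⟫ + ν⟪a x, L x⟫` of the very weak
integrand for a measurable field `a` and continuous test data. [folklore] -/
theorem aestronglyMeasurable_veryWeakIntegrand {a d L : E → E} {D : E → E →L[ℝ] E} {ν : ℝ}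
    {μ : Measure E} (ha : AEStronglyMeasurable a μ) (hd : Continuous d) (hD : Continuous D)
    (hL : Continuous L) :
    AEStronglyMeasurable (fun x => ⟪a x, d x⟫ + ⟪a x, D x (a x)⟫ + ν * ⟪a x, L x⟫) μ := by
  have h2 : AEStronglyMeasurable (fun x => D x (a x)) μ := by
    have := ContinuousLinearMap.aestronglyMeasurable_comp₂ (ContinuousLinearMap.id ℝ (E →L[ℝ] E))
      hD.aestronglyMeasurable ha
    simpa using this
  exact ((ha.inner hd.aestronglyMeasurable).add (ha.inner h2)).add
    ((ha.inner hL.aestronglyMeasurable).const_mul ν)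

/-- **Passage to the limit in the very weak formulation** (the analytic content of Chae 2007,
proof of Thm 1.5, "we can pass to the limit … in the weak formulation", arXiv p. 8; Hou–Li 2007,
§3). Let `w_i` (`i` along a countably generated filter `l`) be fields continuous on the slab
`(−1, 0) × E` satisfying the very weak Navier–Stokes identity there, and let `U` have measurable
slices whose `L^q(B(0,R))` norms are bounded on every compact time interval `[a, b] ⊂ (−1, 0)`,
`q ≥ 2`. If `sup_{−1<s<0} ‖w_i(s) − U(s)‖_{L^q(B(0,R))} → 0` along `l` for every `R`, then `U`
satisfies the very weak identity. Proof: for a test field `ψ` with time support in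
`[a', b'] ⊂ (a₁, b₁) ⋐ (−1, 0)` and space support in `B(0, R)`, the time integrands
`t ↦ ∫ F(w_i)(t)` are measurable (continuity), uniformly bounded, and converge pointwise to
`∫ F(U)(t)` by the slice estimate `lintegral_veryWeakIntegrand_sub_le` and
`L²(B_R) ≤ |B_R|^{1/2−1/q} L^q(B_R)`; dominated convergence on `(a₁, b₁)` and `∫∫ F(w_i) = 0`.
[cite: Chae2007, proof of Thm 1.5 (arXiv p. 8)] -/
theorem integral_veryWeak_eq_zero_of_tendsto
    {ι : Type*} {l : Filter ι} [l.NeBot] [l.IsCountablyGenerated]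
    {ν : ℝ} {q : ℝ≥0∞} (hq : 2 ≤ q) {w : ι → ℝ → E → E} {U : ℝ → E → E}
    (hwc : ∀ᶠ i in l, ContinuousOn (uncurry (w i)) (Ioo (-1) 0 ×ˢ univ))
    (hwid : ∀ᶠ i in l, ∀ ψ : ℝ → E → E, IsSpaceTimeTestOn (slab E (Ioo (-1) 0) isOpen_Ioo) ψ →
      (∀ t, VectorCalculus.IsDivFree (ψ t)) →
      ∫ t in Ioo (-1) 0, ∫ x, (⟪w i t x, timeDeriv ψ t x⟫ + ⟪w i t x, convect (w i t) (ψ t) x⟫ +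
        ν * ⟪w i t x, Δ (ψ t) x⟫) = 0)
    (hUm : ∀ t ∈ Ioo (-1 : ℝ) 0, AEStronglyMeasurable (U t) volume)
    (hUbd : ∀ a b : ℝ, -1 < a → b < 0 → ∀ R : ℝ, ∃ C : ℝ≥0, ∀ t ∈ Icc a b,
      eLpNorm (U t) q (volume.restrict (ball 0 R)) ≤ C)
    (hconv : ∀ R : ℝ, Tendsto (fun i => ⨆ s ∈ Ioo (-1 : ℝ) 0,
      eLpNorm (fun y => w i s y - U s y) q (volume.restrict (ball 0 R))) l (𝓝 0))
    {ψ : ℝ → E → E} (hψ : IsSpaceTimeTestOn (slab E (Ioo (-1) 0) isOpen_Ioo) ψ)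
    (hdiv : ∀ t, VectorCalculus.IsDivFree (ψ t)) :
    ∫ t in Ioo (-1) 0, ∫ x, (⟪U t x, timeDeriv ψ t x⟫ + ⟪U t x, convect (U t) (ψ t) x⟫ +
        ν * ⟪U t x, Δ (ψ t) x⟫) = 0 := by
  -- the very weak integrand
  set Fn : (ℝ → E → E) → ℝ → E → ℝ := fun u t x =>
    ⟪u t x, timeDeriv ψ t x⟫ + ⟪u t x, fderiv ℝ (ψ t) x (u t x)⟫ + ν * ⟪u t x, Δ (ψ t) x⟫ with hFn
  have hFn_apply : ∀ u t x, Fn u t x =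
      ⟪u t x, timeDeriv ψ t x⟫ + ⟪u t x, convect (u t) (ψ t) x⟫ + ν * ⟪u t x, Δ (ψ t) x⟫ :=
    fun u t x => rfl
  simp only [← hFn_apply] at hwid ⊢
  have hwid' : ∀ᶠ i in l, ∫ t in Ioo (-1) 0, ∫ x, Fn (w i) t x = 0 :=
    hwid.mono fun i hi => hi ψ hψ hdiv
  -- Step 0: supports and constants
  have h10 : (-1 : ℝ) < 0 := by norm_num
  obtain ⟨a', b', ha', ha'b', hb', hsupp⟩ := hψ.exists_time_support_Ioo h10
  set a₁ : ℝ := (-1 + a') / 2 with ha₁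
  set b₁ : ℝ := b' / 2 with hb₁
  have h1a₁ : -1 < a₁ := by rw [ha₁]; linarith
  have ha₁a' : a₁ < a' := by rw [ha₁]; linarith
  have hb'b₁ : b' < b₁ := by rw [hb₁]; linarith
  have hb₁0 : b₁ < 0 := by rw [hb₁]; linarith
  have ha₁b₁ : a₁ < b₁ := by linarith
  have hIcc : Icc a₁ b₁ ⊆ Ioo (-1) 0 := fun t ht => ⟨h1a₁.trans_le ht.1, ht.2.trans_lt hb₁0⟩
  have hIoo : Ioo a₁ b₁ ⊆ Ioo (-1) 0 := Ioo_subset_Icc_self.trans hIcc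
  obtain ⟨K, hK, hKt⟩ := hψ.exists_compact_slice_subset
  obtain ⟨R₀, hR₀⟩ := hK.isBounded.subset_closedBall (0 : E)
  set R : ℝ := |R₀| + 1 with hR
  have hRpos : 0 < R := by positivity
  have hKR : K ⊆ ball 0 R :=
    hR₀.trans (closedBall_subset_ball (by rw [hR]; linarith [le_abs_self R₀]))
  obtain ⟨M, hM0, hM⟩ := hψ.exists_uniform_bound
  -- test data vanish off `[a', b']` in time and off `ball 0 R` in space
  have hψK : ∀ t, ∀ x ∉ K, ψ t x = 0 := fun t x hx =>
    image_eq_zero_of_notMem_tsupport fun h' => hx (hKt t h')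
  have hzero_x : ∀ t, ∀ x ∉ ball (0 : E) R,
      timeDeriv ψ t x = 0 ∧ fderiv ℝ (ψ t) x = 0 ∧ Δ (ψ t) x = 0 := by
    intro t x hx
    have hxK : x ∉ K := fun h => hx (hKR h)
    have hxt : x ∉ tsupport (ψ t) := fun h => hxK (hKt t h)
    exact ⟨timeDeriv_eq_zero_of_forall (fun s => hψK s x hxK) t, fderiv_of_notMem_tsupport ℝ hxt,
      laplacian_eq_zero_of_notMem_tsupport hxt⟩
  have hzero_t : ∀ t, t ∉ Icc a' b' → ∀ x,
      timeDeriv ψ t x = 0 ∧ fderiv ℝ (ψ t) x = 0 ∧ Δ (ψ t) x = 0 := by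
    intro t ht x
    refine derived_eq_zero_of_notMem_tsupport (notMem_tsupport_iff_eventuallyEq.2 ?_)
    have hopen : IsOpen ((Icc a' b')ᶜ ×ˢ (univ : Set E)) :=
      isClosed_Icc.isOpen_compl.prod isOpen_univ
    filter_upwards [hopen.mem_nhds (mk_mem_prod ht (mem_univ x))] with z hz
    have hz1 : z.1 ∉ Icc a' b' := hz.1
    simp only [uncurry, hsupp z.1 hz1, Pi.zero_apply]
  have hFn0_t : ∀ u t, t ∉ Icc a' b' → ∀ x, Fn u t x = 0 := by
    intro u t ht x
    obtain ⟨h1, h2, h3⟩ := hzero_t t ht x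
    simp only [hFn, h1, h2, h3, inner_zero_right, zero_apply, mul_zero,
      add_zero]
  -- reduction of the time integral to `(a₁, b₁)`
  have hreduce : ∀ u, ∫ t in Ioo (-1) 0, ∫ x, Fn u t x = ∫ t in Ioo a₁ b₁, ∫ x, Fn u t x := by
    intro u
    refine setIntegral_eq_of_subset_of_forall_sdiff_eq_zero measurableSet_Ioo hIoo fun t ht => ?_
    have ht' : t ∉ Icc a' b' := fun h' => ht.2 ⟨ha₁a'.trans_le h'.1, h'.2.trans_lt hb'b₁⟩
    simp only [hFn0_t u t ht', integral_zero]
  rw [hreduce U]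
  simp only [hreduce] at hwid'
  -- Step 1: constants of the estimates
  set μR : Measure E := volume.restrict (ball (0 : E) R) with hμR
  set V : ℝ≥0∞ := volume (ball (0 : E) R) with hV
  have hVtop : V ≠ (⊤ : ℝ≥0∞) := measure_ball_lt_top.ne
  have hμRuniv : μR univ = V := by rw [hμR, Measure.restrict_apply_univ]
  set c : ℝ≥0∞ := V ^ (1 / (2 : ℝ) - 1 / q.toReal) with hc
  have hexp : 0 ≤ 1 / (2 : ℝ) - 1 / q.toReal := by
    rcases eq_or_ne q (⊤ : ℝ≥0∞) with hq' | hq'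
    · rw [hq', ENNReal.toReal_top]; norm_num
    · have h2 : (2 : ℝ) ≤ q.toReal := by
        have := ENNReal.toReal_mono hq' hq
        simpa using this
      have : 1 / q.toReal ≤ 1 / 2 := one_div_le_one_div_of_le two_pos h2
      linarith
  have hctop : c ≠ (⊤ : ℝ≥0∞) := ENNReal.rpow_ne_top_of_nonneg hexp hVtop
  have hVhalf : V ^ (1 / 2 : ℝ) ≠ (⊤ : ℝ≥0∞) := ENNReal.rpow_ne_top_of_nonneg (by norm_num) hVtop
  -- `L²` on the ball is dominated by `L^q` on the ball
  have he2 : ∀ {f : E → E}, AEStronglyMeasurable f μR → eLpNorm f 2 μR ≤ c * eLpNorm f q μR := by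
    intro f hf
    have := eLpNorm_two_le_mul_eLpNorm hq hf
    rwa [hμRuniv] at this
  -- the bound on `U`
  obtain ⟨CU, hCU⟩ := hUbd a₁ b₁ h1a₁ hb₁0 R
  have hUm' : ∀ t ∈ Ioo a₁ b₁, AEStronglyMeasurable (U t) volume := fun t ht => hUm t (hIoo ht)
  have hU2 : ∀ t ∈ Ioo a₁ b₁, eLpNorm (U t) 2 μR ≤ c * CU := fun t ht =>
    (he2 (hUm' t ht).restrict).trans (mul_le_mul_right (hCU t (Ioo_subset_Icc_self ht)) _)
  -- the deviations
  set δ : ι → ℝ≥0∞ := fun i => ⨆ s ∈ Ioo (-1 : ℝ) 0,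
    eLpNorm (fun y => w i s y - U s y) q μR with hδ
  have hδ0 : Tendsto δ l (𝓝 0) := hconv R
  have hδ1 : ∀ᶠ i in l, δ i < 1 := hδ0.eventually (Iio_mem_nhds zero_lt_one)
  have hdev : ∀ i, ∀ t ∈ Ioo a₁ b₁, eLpNorm (w i t - U t) q μR ≤ δ i := fun i t ht =>
    le_iSup₂ (f := fun s (_ : s ∈ Ioo (-1 : ℝ) 0) => eLpNorm (fun y => w i s y - U s y) q μR)
      t (hIoo ht)
  -- test data at time `t`
  have hMt : ∀ t x, ‖timeDeriv ψ t x‖ ≤ M ∧ ‖fderiv ℝ (ψ t) x‖ ≤ M ∧ ‖Δ (ψ t) x‖ ≤ M := hM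
  have cd : ∀ t, Continuous (timeDeriv ψ t) := fun t =>
    hψ.continuous_timeDeriv.comp (Continuous.prodMk_right t)
  have cD : ∀ t, Continuous fun x => fderiv ℝ (ψ t) x := fun t =>
    ((hψ.contDiff_slice t).continuous_fderiv (by simp))
  have cL : ∀ t, Continuous fun x => Δ (ψ t) x := fun t =>
    continuous_laplacian (contDiff_infty.1 (hψ.contDiff_slice t) 2)
  -- Step 2: slice estimates
  -- (a) integrability of the limit slices
  have hintU : ∀ t ∈ Ioo a₁ b₁, Integrable (fun x => Fn U t x) volume := by
    intro t ht
    refine ⟨aestronglyMeasurable_veryWeakIntegrand (hUm' t ht) (cd t) (cD t) (cL t), ?_⟩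
    rw [hasFiniteIntegral_iff_enorm]
    refine (lintegral_veryWeakIntegrand_le (ν := ν) (hMt t) (hzero_x t) (hUm' t ht)).trans_lt ?_
    have h2 : eLpNorm (U t) 2 μR ≠ (⊤ : ℝ≥0∞) :=
      ne_top_of_le_ne_top (ENNReal.mul_ne_top hctop ENNReal.coe_ne_top) (hU2 t ht)
    refine ENNReal.mul_lt_top (ENNReal.mul_lt_top ENNReal.ofReal_lt_top h2.lt_top) ?_
    exact ENNReal.add_lt_top.2 ⟨ENNReal.mul_lt_top ENNReal.ofReal_lt_top hVhalf.lt_top, h2.lt_top⟩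
  -- (b) joint continuity of the test data
  have c1 : Continuous (uncurry (timeDeriv ψ)) := hψ.continuous_timeDeriv
  have c2 : Continuous fun z : ℝ × E => fderiv ℝ (ψ z.1) z.2 := by
    have := ((hψ.isSmoothSpaceTimeOn univ).fderiv_slice uniqueDiffOn_univ).continuousOn
    rwa [univ_prod_univ, continuousOn_univ] at this
  have c3 : Continuous fun z : ℝ × E => Δ (ψ z.1) z.2 := by
    have := ((hψ.isSmoothSpaceTimeOn univ).laplacian uniqueDiffOn_univ).continuousOn
    rwa [univ_prod_univ, continuousOn_univ] at this
  -- (c) the approximants: continuity, integrability, slice bounds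
  have hGcont : ∀ i, ContinuousOn (uncurry (w i)) (Ioo (-1) 0 ×ˢ univ) →
      ContinuousOn (fun z : ℝ × E => Fn (w i) z.1 z.2) (Icc a₁ b₁ ×ˢ univ) := by
    intro i hwi
    have hu : ContinuousOn (uncurry (w i)) (Icc a₁ b₁ ×ˢ univ) :=
      hwi.mono (prod_mono hIcc Subset.rfl)
    exact ((hu.inner c1.continuousOn).add (hu.inner (c2.continuousOn.clm_apply hu))).add
      (continuousOn_const.mul (hu.inner c3.continuousOn))
  have hGzero : ∀ u, ∀ t ∈ Icc a₁ b₁, ∀ x ∉ closedBall (0 : E) R,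
      (fun z : ℝ × E => Fn u z.1 z.2) (t, x) = 0 := by
    intro u t _ x hx
    have hx' : x ∉ ball (0 : E) R := fun h => hx (ball_subset_closedBall h)
    obtain ⟨h1, h2, h3⟩ := hzero_x t x hx'
    simp only [hFn, h1, h2, h3, inner_zero_right, zero_apply, mul_zero, add_zero]
  have hslice_cont : ∀ i, ContinuousOn (uncurry (w i)) (Ioo (-1) 0 ×ˢ univ) →
      ∀ t ∈ Ioo a₁ b₁, Continuous (w i t) ∧ Continuous fun x => Fn (w i) t x := by
    intro i hwi t ht
    have hmaps : ∀ x ∈ (univ : Set E), (t, x) ∈ Icc a₁ b₁ ×ˢ (univ : Set E) := fun x _ =>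
      mk_mem_prod (Ioo_subset_Icc_self ht) (mem_univ x)
    have h1 : ContinuousOn (fun x => uncurry (w i) (t, x)) univ :=
      (hwi.mono (prod_mono hIcc Subset.rfl)).comp (Continuous.prodMk_right t).continuousOn hmaps
    have h2 : ContinuousOn (fun x => Fn (w i) t x) univ :=
      (hGcont i hwi).comp (Continuous.prodMk_right t).continuousOn hmaps
    exact ⟨continuousOn_univ.1 h1, continuousOn_univ.1 h2⟩
  have hslice_int : ∀ i, ContinuousOn (uncurry (w i)) (Ioo (-1) 0 ×ˢ univ) →
      ∀ t ∈ Ioo a₁ b₁, Integrable (fun x => Fn (w i) t x) volume := by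
    intro i hwi t ht
    refine (hslice_cont i hwi t ht).2.integrable_of_hasCompactSupport ?_
    exact HasCompactSupport.intro (isCompact_closedBall (0 : E) R) fun x hx =>
      hGzero (w i) t (Ioo_subset_Icc_self ht) x hx
  -- `L²` size of the approximants on the ball
  have hw2 : ∀ i, ContinuousOn (uncurry (w i)) (Ioo (-1) 0 ×ˢ univ) → δ i < 1 →
      ∀ t ∈ Ioo a₁ b₁, eLpNorm (w i t - U t) 2 μR ≤ c * δ i ∧
        eLpNorm (w i t) 2 μR ≤ c * (1 + CU) := by
    intro i hwi hδi t ht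
    have hwm : AEStronglyMeasurable (w i t) μR :=
      (hslice_cont i hwi t ht).1.aestronglyMeasurable.restrict
    have hUmR : AEStronglyMeasurable (U t) μR := (hUm' t ht).restrict
    have hd : eLpNorm (w i t - U t) 2 μR ≤ c * δ i :=
      (he2 (hwm.sub hUmR)).trans (mul_le_mul_right (hdev i t ht) _)
    refine ⟨hd, ?_⟩
    calc eLpNorm (w i t) 2 μR = eLpNorm ((w i t - U t) + U t) 2 μR := by rw [sub_add_cancel]
      _ ≤ eLpNorm (w i t - U t) 2 μR + eLpNorm (U t) 2 μR := eLpNorm_add_le (hwm.sub hUmR) hUmR one_le_two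
      _ ≤ c * δ i + c * CU := add_le_add hd (hU2 t ht)
      _ ≤ c * 1 + c * CU := add_le_add (mul_le_mul_right hδi.le _) le_rfl
      _ = c * (1 + CU) := by ring
  -- Step 3: dominated convergence in time
  set K₁ : ℝ≥0∞ := ENNReal.ofReal (1 + |ν|) * V ^ (1 / 2 : ℝ) with hK₁
  have hK₁top : K₁ ≠ (⊤ : ℝ≥0∞) := ENNReal.mul_ne_top ENNReal.ofReal_ne_top hVhalf
  have hcCU : c * (1 + CU) ≠ (⊤ : ℝ≥0∞) := ENNReal.mul_ne_top hctop (by simp)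
  set Bₑ : ℝ≥0∞ := ENNReal.ofReal M * (c * (1 + CU)) * (K₁ + c * (1 + CU)) with hBₑ
  have hBₑtop : Bₑ ≠ (⊤ : ℝ≥0∞) :=
    ENNReal.mul_ne_top (ENNReal.mul_ne_top ENNReal.ofReal_ne_top hcCU) (ENNReal.add_ne_top.2 ⟨hK₁top, hcCU⟩)
  have hgood : ∀ᶠ i in l, ContinuousOn (uncurry (w i)) (Ioo (-1) 0 ×ˢ univ) ∧ δ i < 1 :=
    hwc.and hδ1
  -- (i) measurability of the time integrands
  have hF_meas : ∀ᶠ i in l, AEStronglyMeasurable (fun t => ∫ x, Fn (w i) t x)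
      (volume.restrict (Ioo a₁ b₁)) := by
    filter_upwards [hwc] with i hwi
    have hint := integrable_prod_of_continuousOn (isCompact_closedBall (0 : E) R) (hGcont i hwi)
      (hGzero (w i))
    exact hint.integral_prod_left.aestronglyMeasurable
  -- (ii) the uniform bound
  have h_bound : ∀ᶠ i in l, ∀ᵐ t ∂(volume.restrict (Ioo a₁ b₁)), ‖∫ x, Fn (w i) t x‖ ≤ Bₑ.toReal := by
    filter_upwards [hgood] with i hi
    refine (ae_restrict_iff' measurableSet_Ioo).2 (Eventually.of_forall fun t ht => ?_)
    have hwm : AEStronglyMeasurable (w i t) volume := (hslice_cont i hi.1 t ht).1.aestronglyMeasurable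
    have hlin := lintegral_veryWeakIntegrand_le (ν := ν) (hMt t) (hzero_x t) hwm
    have ha2 := (hw2 i hi.1 hi.2 t ht).2
    refine (norm_integral_le_lintegral_norm _).trans (ENNReal.toReal_mono hBₑtop ?_)
    simp only [ofReal_norm]
    refine hlin.trans ?_
    rw [hBₑ]
    gcongr
  -- (iii) pointwise convergence of the time integrands
  have h_lim : ∀ᵐ t ∂(volume.restrict (Ioo a₁ b₁)),
      Tendsto (fun i => ∫ x, Fn (w i) t x) l (𝓝 (∫ x, Fn U t x)) := by
    refine (ae_restrict_iff' measurableSet_Ioo).2 (Eventually.of_forall fun t ht => ?_)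
    set K₂ : ℝ≥0∞ := K₁ + c + 2 * (c * CU) with hK₂
    have hK₂top : K₂ ≠ (⊤ : ℝ≥0∞) := ENNReal.add_ne_top.2 ⟨ENNReal.add_ne_top.2 ⟨hK₁top, hctop⟩,
      ENNReal.mul_ne_top ENNReal.ofNat_ne_top (ENNReal.mul_ne_top hctop (by simp))⟩
    set g : ι → ℝ := fun i => (ENNReal.ofReal M * (c * δ i) * K₂).toReal with hg
    have hg0 : Tendsto g l (𝓝 0) := by
      have h1 : Tendsto (fun i => c * δ i) l (𝓝 0) := by
        simpa using ENNReal.Tendsto.const_mul hδ0 (Or.inr hctop)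
      have h2 : Tendsto (fun i => ENNReal.ofReal M * (c * δ i)) l (𝓝 0) := by
        simpa using ENNReal.Tendsto.const_mul h1 (Or.inr ENNReal.ofReal_ne_top)
      have h3 : Tendsto (fun i => ENNReal.ofReal M * (c * δ i) * K₂) l (𝓝 0) := by
        simpa using ENNReal.Tendsto.mul_const h2 (Or.inr hK₂top)
      have h4 := (ENNReal.tendsto_toReal ENNReal.zero_ne_top).comp h3
      rw [ENNReal.toReal_zero] at h4
      exact h4
    refine tendsto_iff_norm_sub_tendsto_zero.2 (squeeze_zero' (Eventually.of_forall fun i => norm_nonneg _) ?_ hg0)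
    filter_upwards [hgood] with i hi
    have hwm : AEStronglyMeasurable (w i t) volume := (hslice_cont i hi.1 t ht).1.aestronglyMeasurable
    obtain ⟨hd2, -⟩ := hw2 i hi.1 hi.2 t ht
    rw [← integral_sub (hslice_int i hi.1 t ht) (hintU t ht)]
    have hlin := lintegral_veryWeakIntegrand_sub_le (ν := ν) (hMt t) (hzero_x t) hwm (hUm' t ht)
    have hfin : ENNReal.ofReal M * (c * δ i) * K₂ ≠ (⊤ : ℝ≥0∞) :=
      ENNReal.mul_ne_top (ENNReal.mul_ne_top ENNReal.ofReal_ne_top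
        (ENNReal.mul_ne_top hctop (hi.2.trans ENNReal.one_lt_top).ne)) hK₂top
    refine (norm_integral_le_lintegral_norm _).trans (ENNReal.toReal_mono hfin ?_)
    simp only [ofReal_norm]
    refine hlin.trans ?_
    have hd1 : eLpNorm (w i t - U t) 2 μR ≤ c := (hd2.trans (mul_le_mul_right hi.2.le _)).trans (le_of_eq (mul_one c))
    rw [hK₂]
    gcongr
    · exact hU2 t ht
  -- (iv) conclusion
  have hDCT := tendsto_integral_filter_of_dominated_convergence (fun _ => Bₑ.toReal) hF_meas h_bound
    (integrable_const _) h_lim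
  have h0 : Tendsto (fun i => ∫ t in Ioo a₁ b₁, ∫ x, Fn (w i) t x) l (𝓝 0) :=
    tendsto_const_nhds.congr' (hwid'.mono fun i hi => hi.symm)
  exact tendsto_nhds_unique hDCT h0

end Limit

section Chae

variable {T : ℝ} {z : EuclideanSpace ℝ (Fin 3)} {q : ℝ≥0}
  {v : ℝ → EuclideanSpace ℝ (Fin 3) → EuclideanSpace ℝ (Fin 3)} {π : ℝ → EuclideanSpace ℝ (Fin 3) → ℝ}
  {V : EuclideanSpace ℝ (Fin 3) → EuclideanSpace ℝ (Fin 3)}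

/-- The slices of the backward self-similar field with profile `V` blowing up at `(0, 0)`:
`lerayBackward ½ 0 V t x = (√(−t))⁻¹ • V((√(−t))⁻¹ • x)` (Chae 2007, (3.13) with `T = 0`,
`z = 0`; `√(2·½·(0 − t)) = √(−t)`). [cite: Chae2007, (3.13) (arXiv p. 8)] -/
theorem lerayBackward_half_zero_apply (V : EuclideanSpace ℝ (Fin 3) → EuclideanSpace ℝ (Fin 3)) (t : ℝ)
    (x : EuclideanSpace ℝ (Fin 3)) :
    lerayBackward (1 / 2) 0 V t x = (Real.sqrt (-t))⁻¹ • V ((Real.sqrt (-t))⁻¹ • x) := by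
  rw [lerayBackward_apply]
  norm_num

/-- The slices `u_V(t)`, `t < 0`, of the backward self-similar field are (a.e. strongly)
measurable for a measurable profile `V` (composition with the dilation by `(√(−t))⁻¹ ≠ 0`). [folklore] -/
theorem aestronglyMeasurable_lerayBackward_slice (hV : AEStronglyMeasurable V volume) {t : ℝ}
    (ht : t < 0) : AEStronglyMeasurable (lerayBackward (1 / 2) 0 V t) volume := by
  have hb : (Real.sqrt (-t))⁻¹ ≠ 0 := inv_ne_zero (Real.sqrt_pos.2 (neg_pos.2 ht)).ne'
  have h1 : AEStronglyMeasurable (fun x : EuclideanSpace ℝ (Fin 3) => V ((Real.sqrt (-t))⁻¹ • x))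
      volume :=
    hV.comp_quasiMeasurePreserving (Measure.quasiMeasurePreserving_smul volume hb)
  have h2 := h1.const_smul (Real.sqrt (-t))⁻¹
  refine h2.congr (Eventually.of_forall fun x => ?_)
  simp only [Pi.smul_apply, lerayBackward_half_zero_apply]

/-- **Local `L^q` norms of the slices of `u_V`**: for `−1 < a ≤ t ≤ b < 0` and `R ≥ 0`,
`‖u_V(t)‖_{L^q(B(0,R))} ≤ (√(−b))⁻¹ ‖V‖_{L^q(B(0, R/√(−b)))}` — by the change of variables
`x = √(−t) y` (`eLpNorm_comp_add_smul_restrict_ball`):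
`‖u_V(t)‖_{L^q(B_R)} = (−t)^{−1/2 + 3/(2q)} ‖V‖_{L^q(B(0, R/√(−t)))}` with `(−t)^{3/(2q)} ≤ 1` and
`√(−b) ≤ √(−t) ≤ 1`. [folklore] -/
theorem eLpNorm_lerayBackward_slice_le {a b : ℝ} (ha : -1 < a) (hb : b < 0) {t : ℝ}
    (ht : t ∈ Icc a b) {R : ℝ} (hR : 0 ≤ R) :
    eLpNorm (lerayBackward (1 / 2) 0 V t) (q : ℝ≥0∞) (volume.restrict (ball 0 R)) ≤
      ENNReal.ofReal ((Real.sqrt (-b))⁻¹) *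
        eLpNorm V (q : ℝ≥0∞) (volume.restrict (ball 0 (R / Real.sqrt (-b)))) := by
  have hbpos : 0 < Real.sqrt (-b) := Real.sqrt_pos.2 (neg_pos.2 hb)
  have htneg : 0 < -t := by linarith [ht.2]
  have hst : 0 < Real.sqrt (-t) := Real.sqrt_pos.2 htneg
  have hst1 : Real.sqrt (-t) ≤ 1 := by
    rw [Real.sqrt_le_one]; linarith [ht.1]
  have hsbt : Real.sqrt (-b) ≤ Real.sqrt (-t) := Real.sqrt_le_sqrt (by linarith [ht.2])
  set β : ℝ := (Real.sqrt (-t))⁻¹ with hβ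
  have hβpos : 0 < β := inv_pos.2 hst
  have hfun : lerayBackward (1 / 2) 0 V t =
      β • fun x => V ((0 : EuclideanSpace ℝ (Fin 3)) + β • x) := by
    funext x
    rw [lerayBackward_half_zero_apply, Pi.smul_apply, zero_add]
  rw [hfun, eLpNorm_const_smul, eLpNorm_comp_add_smul_restrict_ball V 0 hβpos R ENNReal.coe_ne_top]
  -- `‖β‖ₑ ≤ (√(-b))⁻¹`
  have h1 : ‖β‖ₑ ≤ ENNReal.ofReal ((Real.sqrt (-b))⁻¹) := by
    rw [Real.enorm_eq_ofReal hβpos.le]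
    exact ENNReal.ofReal_le_ofReal (by rw [hβ]; exact inv_anti₀ hbpos hsbt)
  -- the Jacobian factor is `≤ 1`
  have h2 : ENNReal.ofReal ((β ^ 3)⁻¹) ^ (1 / (q : ℝ≥0∞)).toReal ≤ 1 := by
    refine ENNReal.rpow_le_one (ENNReal.ofReal_le_one.2 ?_) ENNReal.toReal_nonneg
    rw [hβ, inv_pow, inv_inv]
    exact pow_le_one₀ hst.le hst1
  -- the ball grows to `B(0, R/√(-b))`
  have h3 : eLpNorm V (q : ℝ≥0∞) (volume.restrict (ball (0 : EuclideanSpace ℝ (Fin 3)) (β * R))) ≤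
      eLpNorm V (q : ℝ≥0∞) (volume.restrict (ball 0 (R / Real.sqrt (-b)))) := by
    refine eLpNorm_mono_measure _ (Measure.restrict_mono (ball_subset_ball ?_) le_rfl)
    rw [hβ, div_eq_inv_mul]
    exact mul_le_mul_of_nonneg_right (inv_anti₀ hbpos hsbt) hR
  calc ‖β‖ₑ * (ENNReal.ofReal ((β ^ 3)⁻¹) ^ (1 / (q : ℝ≥0∞)).toReal *
        eLpNorm V (q : ℝ≥0∞) (volume.restrict (ball (0 : EuclideanSpace ℝ (Fin 3)) (β * R))))
      ≤ ENNReal.ofReal ((Real.sqrt (-b))⁻¹) *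
          (1 * eLpNorm V (q : ℝ≥0∞) (volume.restrict (ball 0 (R / Real.sqrt (-b))))) := by
        gcongr
    _ = _ := by rw [one_mul]

/-- **The profile is locally in `L^q`** (implicit in Chae 2007, Thm 1.5, where the deviation is
assumed to tend to `0`, in particular to be eventually finite): if `(v, π)` is a classical
solution on `(0, T)`, `V` is measurable and Chae's deviation with parameter `R > 0` tends to `0`
as `t ↑ T`, then `V ∈ L^q(B(0, R))`. Proof: at a time `t ∈ (0, T)` where the deviation is `< 1`
its inner supremum is finite (the power of `T − t` is positive), so at `τ = (t + T)/2` the slice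
`v(τ) − (T−τ)^{−1/2}V((· − z)/√(T−τ))` is in `L^q(B(z, R√(T−t)))`; the classical slice `v(τ)` is
bounded there, hence so is the comparison field, and the change of variables `x = z + √(T−τ) y`
(`eLpNorm_comp_add_smul_restrict_ball`) gives `V ∈ L^q(B(0, R√(T−t)/√(T−τ))) ⊆ L^q(B(0,R))`-wise
the claim (`√(T−τ) ≤ √(T−t)`). [cite: Chae2007, Thm 1.5 (arXiv pp. 4–5)] -/
theorem eLpNorm_profile_lt_top_of_tendsto_chaeLocalDeviation (hT : 0 < T)
    (hv : IsClassicalNSSolutionOn (Ioo 0 T) 1 0 v π) (hVm : AEStronglyMeasurable V volume)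
    {R : ℝ} (hR : 0 < R) (h : Tendsto (chaeLocalDeviation T z q R v V) (𝓝[<] T) (𝓝 0)) :
    eLpNorm V (q : ℝ≥0∞) (volume.restrict (ball 0 R)) < (⊤ : ℝ≥0∞) := by
  -- a time `t ∈ (0, T)` where the deviation is finite
  have h1 : ∀ᶠ t in 𝓝[<] T, chaeLocalDeviation T z q R v V t < 1 :=
    h.eventually (Iio_mem_nhds one_pos)
  have h2 : ∀ᶠ t in 𝓝[<] T, t ∈ Ioo 0 T := Ioo_mem_nhdsLT hT
  obtain ⟨t, ht1, ht⟩ := (h1.and h2).exists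
  have hTt : 0 < T - t := sub_pos.2 ht.2
  set τ : ℝ := (t + T) / 2 with hτ
  have hτt : τ ∈ Ioo t T := ⟨by rw [hτ]; linarith [ht.2], by rw [hτ]; linarith [ht.2]⟩
  have hτ0 : τ ∈ Ioo 0 T := ⟨ht.1.trans hτt.1, hτt.2⟩
  have hTτ : 0 < T - τ := sub_pos.2 hτt.2
  set a : ℝ := Real.sqrt (T - τ) with ha
  have ha0 : 0 < a := Real.sqrt_pos.2 hTτ
  set ρ : ℝ := R * Real.sqrt (T - t) with hρ
  -- the supremum in the deviation is finite, hence so is the term at `τ`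
  rw [chaeLocalDeviation_def] at ht1
  have hpow : ENNReal.ofReal ((T - t) ^ (((q : ℝ) - 3) / (2 * (q : ℝ)))) ≠ 0 :=
    (ENNReal.ofReal_pos.2 (Real.rpow_pos_of_pos hTt _)).ne'
  have hsup : (⨆ τ' ∈ Ioo t T, eLpNorm
      (fun x => v τ' x - (Real.sqrt (T - τ'))⁻¹ • V ((Real.sqrt (T - τ'))⁻¹ • (x - z)))
      (q : ℝ≥0∞) (volume.restrict (ball z ρ))) < (⊤ : ℝ≥0∞) := by
    have hlt := ht1.trans ENNReal.one_lt_top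
    rw [ENNReal.mul_lt_top_iff] at hlt
    rcases hlt with h' | h' | h'
    · exact h'.2
    · exact absurd h' hpow
    · rw [h']; exact ENNReal.zero_lt_top
  have hterm : eLpNorm (fun x => v τ x - a⁻¹ • V (a⁻¹ • (x - z))) (q : ℝ≥0∞)
      (volume.restrict (ball z ρ)) < (⊤ : ℝ≥0∞) :=
    lt_of_le_of_lt (le_iSup₂ (f := fun τ' (_ : τ' ∈ Ioo t T) => eLpNorm
      (fun x => v τ' x - (Real.sqrt (T - τ'))⁻¹ • V ((Real.sqrt (T - τ'))⁻¹ • (x - z)))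
      (q : ℝ≥0∞) (volume.restrict (ball z ρ))) τ hτt) hsup
  -- the classical slice `v τ` is in `L^q` of the ball
  have hvc : Continuous (v τ) := (hv.contDiff_velocity hτ0).continuous
  have hvq : MemLp (v τ) (q : ℝ≥0∞) (volume.restrict (ball z ρ)) := by
    obtain ⟨C, hC⟩ := (isCompact_closedBall z ρ).exists_bound_of_continuousOn hvc.continuousOn
    haveI : IsFiniteMeasure (volume.restrict (ball z ρ)) :=
      isFiniteMeasure_restrict.2 measure_ball_lt_top.ne
    refine (memLp_top_of_bound hvc.aestronglyMeasurable.restrict C ?_).mono_exponent le_top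
    exact (ae_restrict_iff' measurableSet_ball).2 (Eventually.of_forall fun x hx =>
      hC x (ball_subset_closedBall hx))
  -- the comparison field is measurable
  set G : EuclideanSpace ℝ (Fin 3) → EuclideanSpace ℝ (Fin 3) :=
    fun x => a⁻¹ • V (a⁻¹ • (x - z)) with hG
  set F : EuclideanSpace ℝ (Fin 3) → EuclideanSpace ℝ (Fin 3) := fun x => V (a⁻¹ • (x - z))
    with hF
  have hFm : AEStronglyMeasurable F volume :=
    (hVm.comp_quasiMeasurePreserving (Measure.quasiMeasurePreserving_smul volume
      (inv_ne_zero ha0.ne'))).comp_quasiMeasurePreserving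
      (measurePreserving_sub_right volume z).quasiMeasurePreserving
  have hGm : AEStronglyMeasurable G volume := hFm.const_smul a⁻¹
  -- hence `G ∈ L^q(B(z, ρ))` and so is `F = a • G`
  have hGq : MemLp G (q : ℝ≥0∞) (volume.restrict (ball z ρ)) := by
    have hD : MemLp (fun x => v τ x - G x) (q : ℝ≥0∞) (volume.restrict (ball z ρ)) :=
      ⟨(hvc.aestronglyMeasurable.sub hGm).restrict, hterm⟩
    have := hvq.sub hD
    have hfun : (v τ - fun x => v τ x - G x) = G := by funext x; simp
    rwa [hfun] at this
  have hFq : eLpNorm F (q : ℝ≥0∞) (volume.restrict (ball z ρ)) < (⊤ : ℝ≥0∞) := by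
    have hFG : F = a • G := by
      funext x
      simp only [hG, hF, Pi.smul_apply, smul_smul, mul_inv_cancel₀ ha0.ne', one_smul]
    rw [hFG, eLpNorm_const_smul]
    exact ENNReal.mul_lt_top enorm_lt_top hGq.eLpNorm_lt_top
  -- change variables `x = z + a y`
  have hcv := eLpNorm_comp_add_smul_restrict_ball F z ha0 (ρ / a) (p := (q : ℝ≥0∞)) ENNReal.coe_ne_top
  have hFy : (fun y => F (z + a • y)) = V := by
    funext y
    simp only [hF, add_sub_cancel_left, smul_smul, inv_mul_cancel₀ ha0.ne', one_smul]
  rw [hFy, mul_div_cancel₀ ρ ha0.ne'] at hcv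
  have hVq : eLpNorm V (q : ℝ≥0∞) (volume.restrict (ball 0 (ρ / a))) < (⊤ : ℝ≥0∞) := by
    rw [hcv]
    exact ENNReal.mul_lt_top (ENNReal.rpow_lt_top_of_nonneg ENNReal.toReal_nonneg
      ENNReal.ofReal_ne_top) hFq
  -- `B(0, R) ⊆ B(0, ρ/a)`
  refine lt_of_le_of_lt (eLpNorm_mono_measure _ (Measure.restrict_mono (ball_subset_ball ?_) le_rfl))
    hVq
  rw [hρ, mul_div_assoc]
  refine le_mul_of_one_le_right hR.le ((one_le_div ha0).2 ?_)
  rw [ha]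
  exact Real.sqrt_le_sqrt (by linarith [hτt.1])

/-- Integrability of `x ↦ ⟪f x, g x⟫` on `ℝ³` for `f ∈ L^p(B(0,R))`, `p ≥ 1`, and `g` measurable,
bounded and vanishing off `B(0, R)` (`L^p ⊂ L¹` on the ball). [folklore] -/
theorem integrable_inner_of_eLpNorm_ball_lt_top {p : ℝ≥0∞} (hp : 1 ≤ p)
    {f g : EuclideanSpace ℝ (Fin 3) → EuclideanSpace ℝ (Fin 3)} {R M : ℝ}
    (hf : AEStronglyMeasurable f volume)
    (hfp : eLpNorm f p (volume.restrict (ball 0 R)) < (⊤ : ℝ≥0∞))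
    (hg : AEStronglyMeasurable g volume) (hgM : ∀ x, ‖g x‖ ≤ M)
    (hgR : ∀ x ∉ ball (0 : EuclideanSpace ℝ (Fin 3)) R, g x = 0) :
    Integrable (fun x => ⟪f x, g x⟫) volume := by
  have hsupp : support (fun x => ⟪f x, g x⟫) ⊆ ball 0 R := by
    intro x hx
    by_contra hxR
    simp [hgR x hxR] at hx
  refine (integrableOn_iff_integrable_of_support_subset hsupp).1 ?_
  haveI : IsFiniteMeasure (volume.restrict (ball (0 : EuclideanSpace ℝ (Fin 3)) R)) :=
    isFiniteMeasure_restrict.2 measure_ball_lt_top.ne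
  have hfp' : MemLp f p (volume.restrict (ball 0 R)) := ⟨hf.restrict, hfp⟩
  have hf1 : Integrable f (volume.restrict (ball 0 R)) :=
    memLp_one_iff_integrable.1 (hfp'.mono_exponent hp)
  refine Integrable.mono' (hf1.norm.const_mul M) (hf.restrict.inner hg.restrict)
    (Eventually.of_forall fun x => ?_)
  calc ‖⟪f x, g x⟫‖ ≤ ‖f x‖ * ‖g x‖ := norm_inner_le_norm _ _
    _ ≤ ‖f x‖ * M := mul_le_mul_of_nonneg_left (hgM x) (norm_nonneg _)
    _ = M * ‖f x‖ := mul_comm _ _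

/-- **Weak divergence-freeness passes to local `L^p` limits**, `p ≥ 1`: if the fields `w_i` are
weakly divergence free and measurable (eventually along a filter `l`), `u` is measurable and in
`L^p(B(0,R))` for every `R`, and `‖w_i − u‖_{L^p(B(0,R))} → 0` along `l` for every `R`, then `u` is
weakly divergence free (`|∫⟪w_i − u, ∇θ⟫| ≤ sup|∇θ| |B_R|^{1−1/p} ‖w_i − u‖_{L^p(B_R)}` for a test
function `θ` supported in `B(0, R)`). [folklore] -/
theorem isWeaklyDivFree_of_tendsto_eLpNorm_sub {ι : Type*} {l : Filter ι} [l.NeBot]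
    {p : ℝ≥0∞} (hp : 1 ≤ p) {w : ι → EuclideanSpace ℝ (Fin 3) → EuclideanSpace ℝ (Fin 3)}
    {u : EuclideanSpace ℝ (Fin 3) → EuclideanSpace ℝ (Fin 3)}
    (hw : ∀ᶠ i in l, IsWeaklyDivFree (w i)) (hwm : ∀ᶠ i in l, AEStronglyMeasurable (w i) volume)
    (hum : AEStronglyMeasurable u volume)
    (hup : ∀ R : ℝ, eLpNorm u p (volume.restrict (ball 0 R)) < (⊤ : ℝ≥0∞))
    (hconv : ∀ R : ℝ, Tendsto (fun i => eLpNorm (w i - u) p (volume.restrict (ball 0 R))) l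
      (𝓝 0)) :
    IsWeaklyDivFree u := by
  intro θ hθ
  -- the gradient of the test function: continuous, bounded, supported in a ball
  set g : EuclideanSpace ℝ (Fin 3) → EuclideanSpace ℝ (Fin 3) := gradient θ with hg
  have hgc : Continuous g :=
    (InnerProductSpace.toDual ℝ (EuclideanSpace ℝ (Fin 3))).symm.continuous.comp
      (hθ.contDiff.continuous_fderiv (by simp))
  have hgs : HasCompactSupport g :=
    (hθ.hasCompactSupport.fderiv (𝕜 := ℝ)).comp_left (map_zero _)
  obtain ⟨M, hM⟩ := hgc.bounded_above_of_compact_support hgs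
  obtain ⟨R₀, hR₀⟩ := hgs.isCompact.isBounded.subset_closedBall (0 : EuclideanSpace ℝ (Fin 3))
  set R : ℝ := |R₀| + 1 with hR
  have hgR : ∀ x ∉ ball (0 : EuclideanSpace ℝ (Fin 3)) R, g x = 0 := by
    intro x hx
    refine image_eq_zero_of_notMem_tsupport fun h' => hx ?_
    exact closedBall_subset_ball (by rw [hR]; linarith [le_abs_self R₀]) (hR₀ h')
  -- constants
  set μR : Measure (EuclideanSpace ℝ (Fin 3)) :=
    volume.restrict (ball (0 : EuclideanSpace ℝ (Fin 3)) R) with hμR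
  set V : ℝ≥0∞ := volume (ball (0 : EuclideanSpace ℝ (Fin 3)) R) with hV
  have hVtop : V ≠ (⊤ : ℝ≥0∞) := measure_ball_lt_top.ne
  set c : ℝ≥0∞ := V ^ (1 / (1 : ℝ≥0∞).toReal - 1 / p.toReal) with hc
  have hexp : 0 ≤ 1 / (1 : ℝ≥0∞).toReal - 1 / p.toReal := by
    rcases eq_or_ne p (⊤ : ℝ≥0∞) with hp' | hp'
    · rw [hp', ENNReal.toReal_top]; norm_num
    · have h1 : (1 : ℝ) ≤ p.toReal := by
        have := ENNReal.toReal_mono hp' hp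
        simpa using this
      have : 1 / p.toReal ≤ 1 := (div_le_one (by linarith)).2 h1
      simp only [ENNReal.toReal_one, div_one]
      linarith
  have hctop : c ≠ (⊤ : ℝ≥0∞) := ENNReal.rpow_ne_top_of_nonneg hexp hVtop
  -- eventually the approximants are in `L^p` of the ball
  have hfin : ∀ᶠ i in l, eLpNorm (w i - u) p μR < 1 := (hconv R).eventually (Iio_mem_nhds one_pos)
  -- convergence of the pairings
  have hkey : Tendsto (fun i => ∫ x, ⟪w i x, g x⟫) l (𝓝 (∫ x, ⟪u x, g x⟫)) := by
    have hbound : Tendsto (fun i => (ENNReal.ofReal M * (eLpNorm (w i - u) p μR * c)).toReal) l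
        (𝓝 0) := by
      have h1 : Tendsto (fun i => eLpNorm (w i - u) p μR * c) l (𝓝 0) := by
        simpa using ENNReal.Tendsto.mul_const (hconv R) (Or.inr hctop)
      have h2 : Tendsto (fun i => ENNReal.ofReal M * (eLpNorm (w i - u) p μR * c)) l (𝓝 0) := by
        simpa using ENNReal.Tendsto.const_mul h1 (Or.inr ENNReal.ofReal_ne_top)
      have h3 := (ENNReal.tendsto_toReal ENNReal.zero_ne_top).comp h2
      rw [ENNReal.toReal_zero] at h3
      exact h3
    refine tendsto_iff_norm_sub_tendsto_zero.2
      (squeeze_zero' (Eventually.of_forall fun i => norm_nonneg _) ?_ hbound)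
    filter_upwards [hwm, hfin] with i hwi hfi
    have hup' : eLpNorm u p μR < (⊤ : ℝ≥0∞) := hup R
    have hwp : eLpNorm (w i) p μR < (⊤ : ℝ≥0∞) := by
      calc eLpNorm (w i) p μR = eLpNorm ((w i - u) + u) p μR := by rw [sub_add_cancel]
        _ ≤ eLpNorm (w i - u) p μR + eLpNorm u p μR :=
            eLpNorm_add_le (hwi.sub hum).restrict hum.restrict hp
        _ < ⊤ := ENNReal.add_lt_top.2 ⟨hfi.trans ENNReal.one_lt_top, hup'⟩
    have hIw := integrable_inner_of_eLpNorm_ball_lt_top hp hwi hwp hgc.aestronglyMeasurable hM hgR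
    have hIu := integrable_inner_of_eLpNorm_ball_lt_top hp hum hup' hgc.aestronglyMeasurable hM hgR
    rw [← integral_sub hIw hIu]
    have hfinite : ENNReal.ofReal M * (eLpNorm (w i - u) p μR * c) ≠ (⊤ : ℝ≥0∞) :=
      ENNReal.mul_ne_top ENNReal.ofReal_ne_top
        (ENNReal.mul_ne_top (hfi.trans ENNReal.one_lt_top).ne hctop)
    refine (norm_integral_le_lintegral_norm _).trans (ENNReal.toReal_mono hfinite ?_)
    -- pointwise `‖⟪w - u, g⟫‖ ≤ M ‖w - u‖` on the ball, zero outside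
    have hsupp : support (fun x => ENNReal.ofReal ‖⟪w i x, g x⟫ - ⟪u x, g x⟫‖) ⊆ ball 0 R := by
      intro x hx
      by_contra hxR
      simp [hgR x hxR] at hx
    rw [← setLIntegral_eq_of_support_subset hsupp]
    calc ∫⁻ x in ball 0 R, ENNReal.ofReal ‖⟪w i x, g x⟫ - ⟪u x, g x⟫‖
        ≤ ∫⁻ x in ball 0 R, ENNReal.ofReal M * ‖(w i - u) x‖ₑ := by
          refine lintegral_mono fun x => ?_
          rw [← inner_sub_left, ← ofReal_norm, ← ENNReal.ofReal_mul ((norm_nonneg _).trans (hM x))]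
          refine ENNReal.ofReal_le_ofReal ?_
          calc ‖⟪w i x - u x, g x⟫‖ ≤ ‖w i x - u x‖ * ‖g x‖ := norm_inner_le_norm _ _
            _ ≤ ‖w i x - u x‖ * M := mul_le_mul_of_nonneg_left (hM x) (norm_nonneg _)
            _ = M * ‖(w i - u) x‖ := by rw [mul_comm]; rfl
      _ = ENNReal.ofReal M * eLpNorm (w i - u) 1 μR := by
          rw [lintegral_const_mul' _ _ ENNReal.ofReal_ne_top, eLpNorm_one_eq_lintegral_enorm]
      _ ≤ ENNReal.ofReal M * (eLpNorm (w i - u) p μR * c) := by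
          gcongr
          have := eLpNorm_le_eLpNorm_mul_rpow_measure_univ hp ((hwi.sub hum).restrict (s := ball 0 R))
          rwa [Measure.restrict_apply_univ] at this
  -- the pairings of the approximants vanish
  have h0 : Tendsto (fun i => ∫ x, ⟪w i x, g x⟫) l (𝓝 0) :=
    tendsto_const_nhds.congr' (hw.mono fun i hi => (hi θ hθ).symm)
  exact tendsto_nhds_unique hkey h0

/-- The profile is in `L^q(B(0, R))` for every real `R` when the deviation tends to `0` for every
`R > 0` (`eLpNorm_profile_lt_top_of_tendsto_chaeLocalDeviation`; empty ball for `R ≤ 0`).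
[cite: Chae2007, Thm 1.5 (arXiv pp. 4–5)] -/
theorem eLpNorm_profile_ball_lt_top (hT : 0 < T) (hv : IsClassicalNSSolutionOn (Ioo 0 T) 1 0 v π)
    (hVm : AEStronglyMeasurable V volume)
    (hdev : ∀ R : ℝ, 0 < R → Tendsto (chaeLocalDeviation T z q R v V) (𝓝[<] T) (𝓝 0)) (R : ℝ) :
    eLpNorm V (q : ℝ≥0∞) (volume.restrict (ball 0 R)) < (⊤ : ℝ≥0∞) := by
  rcases le_or_gt R 0 with hR | hR
  · rw [Metric.ball_eq_empty.2 hR, Measure.restrict_empty, eLpNorm_measure_zero]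
    exact ENNReal.zero_lt_top
  · exact eLpNorm_profile_lt_top_of_tendsto_chaeLocalDeviation hT hv hVm hR (hdev R hR)

/-- The slices `u_V(t)`, `−1 < t < 0`, are in `L^q(B(0, R))` for every real `R` under the
hypothesis of Theorem 1.5 in normal form (`eLpNorm_lerayBackward_slice_le` with `a = b = t` and
`eLpNorm_profile_ball_lt_top`). [cite: Chae2007, Thm 1.5 (arXiv pp. 4–5)] -/
theorem eLpNorm_lerayBackward_slice_lt_top (hT : 0 < T)
    (hv : IsClassicalNSSolutionOn (Ioo 0 T) 1 0 v π) (hVm : AEStronglyMeasurable V volume)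
    (hdev : ∀ R : ℝ, 0 < R → Tendsto (chaeLocalDeviation T z q R v V) (𝓝[<] T) (𝓝 0))
    {t : ℝ} (ht : t ∈ Ioo (-1 : ℝ) 0) (R : ℝ) :
    eLpNorm (lerayBackward (1 / 2) 0 V t) (q : ℝ≥0∞) (volume.restrict (ball 0 R)) < (⊤ : ℝ≥0∞) := by
  rcases le_or_gt R 0 with hR | hR
  · rw [Metric.ball_eq_empty.2 hR, Measure.restrict_empty, eLpNorm_measure_zero]
    exact ENNReal.zero_lt_top
  · refine lt_of_le_of_lt (eLpNorm_lerayBackward_slice_le (V := V) ht.1 ht.2 ⟨le_rfl, le_rfl⟩ hR.le) ?_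
    exact ENNReal.mul_lt_top ENNReal.ofReal_lt_top (eLpNorm_profile_ball_lt_top hT hv hVm hdev _)

/-- The rescaling parameters `c` with `0 < c`, `c² ≤ T` form a neighbourhood of `0⁺` (they
contain `(0, √T)`). [folklore] -/
theorem eventually_nhdsGT_sq_le (hT : 0 < T) : ∀ᶠ c in 𝓝[>] (0 : ℝ), 0 < c ∧ c ^ 2 ≤ T := by
  filter_upwards [Ioo_mem_nhdsGT (Real.sqrt_pos.2 hT)] with c hc
  refine ⟨hc.1, ?_⟩
  nlinarith [Real.sq_sqrt hT.le, Real.sqrt_nonneg T, hc.1, hc.2]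

/-- **Chae 2007, proof of Theorem 1.5 — the weak limit** (arXiv p. 8: "Using this convergence,
we can pass to the limit … in the weak formulation of `(NS₁)` … `V̄` is a weak solution of the
stationary Leray system"; here before the passage to similarity variables). Let `T > 0`, let
`(v, π)` be a classical solution of Navier–Stokes (`ν = 1`, `f = 0`) on `ℝ³ × (0, T)`, let `V` be
measurable, `q ≥ 2`, and suppose Chae's deviation `chaeLocalDeviation T z q R v V` tends to `0`
as `t ↑ T` for every `R > 0` (the hypothesis of Theorem 1.5 in normal form,
`forall_tendsto_chaeLocalDeviation_of_hyp`). Then the backward self-similar field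
`u_V = lerayBackward ½ 0 V` (`u_V(s, y) = (−s)^{-1/2} V(y/√(−s))`) is a very weak solution of
Navier–Stokes on the slab `(−1, 0) × ℝ³`:
`∫_{−1}^{0} ∫ (⟪u_V, ∂ₜψ⟫ + ⟪u_V, (u_V·∇)ψ⟫ + ⟪u_V, Δψ⟫) = 0` for every smooth compactly supported
`ψ` on the slab with divergence-free slices. Proof: `integral_veryWeak_eq_zero_of_tendsto` along
`λ ↓ 0` for the classical rescalings `v_λ` (`nsRescale_blowup`, `integral_veryWeak_eq_zero`),
which converge to `u_V` by `tendsto_iSup_nsRescale_sub_lerayBackward`; the local bounds on `u_V`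
are `eLpNorm_lerayBackward_slice_le` with `eLpNorm_profile_ball_lt_top`.
[cite: Chae2007, proof of Thm 1.5 (arXiv p. 8)] -/
theorem integral_veryWeak_lerayBackward_eq_zero (hT : 0 < T)
    (hv : IsClassicalNSSolutionOn (Ioo 0 T) 1 0 v π) (hVm : AEStronglyMeasurable V volume)
    (hq : 2 ≤ q)
    (hdev : ∀ R : ℝ, 0 < R → Tendsto (chaeLocalDeviation T z q R v V) (𝓝[<] T) (𝓝 0))
    {ψ : ℝ → EuclideanSpace ℝ (Fin 3) → EuclideanSpace ℝ (Fin 3)}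
    (hψ : IsSpaceTimeTestOn (slab (EuclideanSpace ℝ (Fin 3)) (Ioo (-1) 0) isOpen_Ioo) ψ)
    (hdivψ : ∀ t, VectorCalculus.IsDivFree (ψ t)) :
    ∫ t in Ioo (-1) 0, ∫ x, (⟪lerayBackward (1 / 2) 0 V t x, timeDeriv ψ t x⟫ +
      ⟪lerayBackward (1 / 2) 0 V t x, convect (lerayBackward (1 / 2) 0 V t) (ψ t) x⟫ +
      1 * ⟪lerayBackward (1 / 2) 0 V t x, Δ (ψ t) x⟫) = 0 := by
  have hgood := eventually_nhdsGT_sq_le hT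
  have hq' : (2 : ℝ≥0∞) ≤ (q : ℝ≥0∞) := by exact_mod_cast hq
  refine integral_veryWeak_eq_zero_of_tendsto (l := 𝓝[>] (0 : ℝ)) (ν := 1)
    (w := fun c => FluidPDE.nsRescale c fun τ x => v (T + τ) (z + x))
    (U := lerayBackward (1 / 2) 0 V) hq' ?_ ?_ ?_ ?_ ?_ hψ hdivψ
  · filter_upwards [hgood] with c hc
    exact (hv.nsRescale_blowup hc.1 hc.2).smooth_velocity.continuousOn
  · filter_upwards [hgood] with c hc
    intro ψ' hψ' hdiv'
    exact (hv.nsRescale_blowup hc.1 hc.2).integral_veryWeak_eq_zero hψ' hdiv'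
  · exact fun t ht => aestronglyMeasurable_lerayBackward_slice hVm ht.2
  · intro a b ha hb R
    have hfin : ENNReal.ofReal ((Real.sqrt (-b))⁻¹) *
        eLpNorm V (q : ℝ≥0∞) (volume.restrict (ball 0 (|R| / Real.sqrt (-b)))) < (⊤ : ℝ≥0∞) :=
      ENNReal.mul_lt_top ENNReal.ofReal_lt_top (eLpNorm_profile_ball_lt_top hT hv hVm hdev _)
    refine ⟨(ENNReal.ofReal ((Real.sqrt (-b))⁻¹) *
        eLpNorm V (q : ℝ≥0∞) (volume.restrict (ball 0 (|R| / Real.sqrt (-b))))).toNNReal,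
      fun t ht => ?_⟩
    rw [ENNReal.coe_toNNReal hfin.ne]
    calc eLpNorm (lerayBackward (1 / 2) 0 V t) (q : ℝ≥0∞) (volume.restrict (ball 0 R))
        ≤ eLpNorm (lerayBackward (1 / 2) 0 V t) (q : ℝ≥0∞) (volume.restrict (ball 0 |R|)) :=
          eLpNorm_mono_measure _ (Measure.restrict_mono (ball_subset_ball (le_abs_self R)) le_rfl)
      _ ≤ _ := eLpNorm_lerayBackward_slice_le ha hb ht (abs_nonneg R)
  · intro R
    rcases le_or_gt R 0 with hR | hR
    · simp only [Metric.ball_eq_empty.2 hR, Measure.restrict_empty, eLpNorm_measure_zero,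
        ENNReal.iSup_zero]
      exact tendsto_const_nhds
    · exact tendsto_iSup_nsRescale_sub_lerayBackward (hdev R hR)

/-- **The slices of the weak limit are weakly divergence free** (Chae 2007, proof of Thm 1.5,
the constraint `div V = 0` of `(NS₁)` in the limit): under the hypotheses of
`integral_veryWeak_lerayBackward_eq_zero` (here `q ≥ 1` suffices), every slice `u_V(t)`,
`−1 < t < 0`, is weakly divergence free — the divergence-free classical slices `v_λ(t)` converge
to it in `L^q(B(0,R))` for every `R` (`isWeaklyDivFree_of_tendsto_eLpNorm_sub`).
[cite: Chae2007, proof of Thm 1.5 (arXiv p. 8)] -/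
theorem isWeaklyDivFree_lerayBackward_slice (hT : 0 < T)
    (hv : IsClassicalNSSolutionOn (Ioo 0 T) 1 0 v π) (hVm : AEStronglyMeasurable V volume)
    (hq : 1 ≤ q)
    (hdev : ∀ R : ℝ, 0 < R → Tendsto (chaeLocalDeviation T z q R v V) (𝓝[<] T) (𝓝 0))
    {t : ℝ} (ht : t ∈ Ioo (-1 : ℝ) 0) :
    IsWeaklyDivFree (lerayBackward (1 / 2) 0 V t) := by
  have hgood := eventually_nhdsGT_sq_le hT
  have hq' : (1 : ℝ≥0∞) ≤ (q : ℝ≥0∞) := by exact_mod_cast hq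
  refine isWeaklyDivFree_of_tendsto_eLpNorm_sub (l := 𝓝[>] (0 : ℝ)) hq'
    (w := fun c => FluidPDE.nsRescale c (fun τ x => v (T + τ) (z + x)) t) ?_ ?_
    (aestronglyMeasurable_lerayBackward_slice hVm ht.2)
    (eLpNorm_lerayBackward_slice_lt_top hT hv hVm hdev ht) ?_
  · filter_upwards [hgood] with c hc
    exact (hv.nsRescale_blowup hc.1 hc.2).isWeaklyDivFree_slice ht
  · filter_upwards [hgood] with c hc
    exact ((hv.nsRescale_blowup hc.1 hc.2).contDiff_velocity ht).continuous.aestronglyMeasurable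
  · intro R
    rcases le_or_gt R 0 with hR | hR
    · simp only [Metric.ball_eq_empty.2 hR, Measure.restrict_empty, eLpNorm_measure_zero]
      exact tendsto_const_nhds
    · refine tendsto_of_tendsto_of_tendsto_of_le_of_le tendsto_const_nhds
        (tendsto_iSup_nsRescale_sub_lerayBackward (hdev R hR)) (fun _ => bot_le) fun c => ?_
      exact le_iSup₂ (f := fun s (_ : s ∈ Ioo (-1 : ℝ) 0) => eLpNorm
        (fun y => FluidPDE.nsRescale c (fun τ x => v (T + τ) (z + x)) s y - lerayBackward (1 / 2) 0 V s y)
        (q : ℝ≥0∞) (volume.restrict (ball 0 R))) t ht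

end Chae

end Literature.Analysis.FluidPDE

end
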